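import Literature.Topology.FourManifolds.LatticeFormsPolarisationTypesOrbitNumber
import HarnessLib

/-!
# The number of polarisation types of divisor `f` in `L_{2t} = B₀ ⊕ ⟨−2t⟩` for a general `w`: the admissible classes
# `c mod f` number `w₊(f₁)φ(w₋(f₁)) · 2^{ρ(f₁)}` resp. `· 2^{ρ(f₁/2)}`, i.e. `N · φ(f₁) = φ(f) · 2^{ρ}`
# (Gritsenko–Hulek–Sankaran, *Compositio Math.* 146 (2010), §4 Prop. 4.6 (i)–(iii) for every `w`, and the last sentence of (iv))

Trunk T-4MAN vocabulary; sequel of `LatticeFormsPolarisationTypesOrbitNumber.lean` (row g44-#3: the case `w = 1`, whose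
`TODO(general form): w > 1 (the factor w₊(f₁)φ(w₋(f₁)))` this file settles), of `LatticeFormsPolarisationTypesGeneralDivisor.lean`
(row g43-#2: the `Õ(L)`-orbits of primitive `h ∈ L = B₀ ⊕ ⟨−2t⟩` with `h² = 2d`, `(h, L) = fℤ` ↔ the admissible classes
`{c mod f : (c, f) = 1, f² ∣ d + c²t}`, `natCard_quot_stable_isometryEquiv_two_mul_of_divisor`; Prop. 4.6 (iv) `h^⊥ ≅ … ⊕ B`),
of `LatticeFormsPolarisationTypesOrthogonalOrbits.lean` (g44-#1: `dvd_add_mul_sq_of_sq_dvd`) and of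
`LatticeFormsRankOneDiscriminantFormIsometries.lean` (g39: `#{y ∈ ℤ/m : y² = 1} = 2^{ω(m)}` for odd `m`,
`#{u ∈ ℤ/2n : 4n ∣ u² − 1} = 2^{ω(n)}`). Written for lane `lit-hodgefound` (Track 2 foundations; prover seat `lit-hodgefound-p18`,
gen 45, row g45-#1). THEOREMS ONLY — no definition, no named fact, no instance, no notation.

## Source, verbatim (V. Gritsenko, K. Hulek, G. K. Sankaran, Compositio Math. 146 (2010) 404–434, arXiv numbering §4,
held text `paper:arxiv-0802.2078` pp. 10–11)

"**Proposition 4.6.** Let `h_d ∈ L_{2t}` be primitive of length `2d > 0` and `div(h_d) = f`. We put `g = (2t/f, 2d/f)`,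
`w = (g, f)`, `g = wg₁`, `f = wf₁`. Then `2t = fgt₁ = w²f₁g₁t₁` and `2d = fgd₁ = w²f₁g₁d₁` where `(t₁, d₁) = (f₁, g₁) = 1`.
(i) If `g₁` is even, then such an `h_d` exists if and only if `(d₁, f₁) = (f₁, t₁) = 1` and `−d₁/t₁` is a quadratic residue
modulo `f₁`. Moreover the number of `Õ(L_{2t})`-orbits of `h_d` with fixed `f` (if at least one `h_d` exists) is equal to
`w₊(f₁)φ(w₋(f₁)) · 2^{ρ(f₁)}`, where `w = w₊(f₁)w₋(f₁)` and `w₊(f₁)` is the product of all powers of primes dividing `(w, f₁)`,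
`ρ(n)` is the number of prime factors of `n` and `φ(n)` is the Euler function. (ii) If `g₁` is odd, and `f₁` is even or `f₁`
and `d₁` are both odd, then such an `h_d` exists if and only if `(d₁, f₁) = (t₁, 2f₁) = 1` and `−d₁/t₁` is a quadratic residue
modulo `2f₁`. The number of `Õ(L_{2t})`-orbits of such `h_d` is equal to `w₊(f₁)φ(w₋(f₁)) · 2^{ρ(f₁/2)}` if `f₁ ≡ 0 mod 2`
and to `w₊(f₁)φ(w₋(f₁)) · 2^{ρ(f₁)}` if `f₁ ≡ d₁ ≡ 1 mod 2`. (iii) If `g₁` and `f₁` are both odd and `d₁` is even, then such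
an `h_d` exists if and only if `(d₁, f₁) = (t₁, 2f₁) = 1`, `−d₁/(4t₁)` is a quadratic residue modulo `f₁` and `w` is odd. The
number of `Õ(L_{2t})`-orbits of such `h_d` is equal to `w₊(f₁)φ(w₋(f₁)) · 2^{ρ(f₁)}`. (iv) For `c` a suitable integer,
determined mod `f` and satisfying `(c, f) = 1`, and `b = (d + c²t)/f²`, we have `(h_d)^⊥_{L_{2t}} ≅ 2U ⊕ 2E₈(−1) ⊕ B` with
`B = (−2b, c·2t/f; c·2t/f, −2t)`. […] The greatest common divisor of the elements of `B` is equal to `g₁(2b/g₁, w)`.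
*Proof.* […] the `Õ(L_{2t})`-orbit of `h_d` is uniquely determined by `h_d^* ≡ (c/f) l_t mod L_{2t}`. Therefore it is
determined by `c mod f` […] We put `v² = 2b`. Then `2d = 2bf² − 2c²t`, or `2f₁b = g₁(d₁ + c²t₁)` (c-eq) […] (i) […]
Equation (c-eq) is equivalent to the congruence `t₁c₁² ≡ −d₁ mod f₁`, `c₁ ≡ c mod f₁` […] the number of solutions `c₁` of
(c1-cong0) taken modulo `f₁` is equal to `#{x mod f₁ ∣ x² ≡ 1 mod f₁} = 2^{ρ(f₁)}`. Let us calculate the number of solutions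
`c` modulo `f` where `f = wf₁`. Any solution `c₁` is coprime to `f₁`. Let us put `c = c₁ + (x + yw₋(f₁))f₁` where `x` is
taken mod `w₋(f₁)` and `y` is taken mod `w₊(f₁)`. We note that `(f₁, w₋(f₁)) = 1`. We have `(c, wf₁) = 1` if and only if
`(c₁ + xf₁, w₋(f₁)) = 1`. For any fixed `c₁` the numbers `c₁ + xf₁` form the full residue system modulo `w₋(f₁)` if `x` runs
modulo `w₋(f₁)`. Therefore for any fixed `c₁` there are exactly `w₊(f₁)φ(w₋(f₁))` solutions `c` modulo `f = f₁w` such that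
`c ≡ c₁ mod f₁` and `(c, f) = 1`. This finishes the proof of (i). (ii) […] If `f₁` is even, then […] Equation (c-eq) is
equivalent to the congruence `t₁c₁² ≡ −d₁ mod 2f₁`, `c₁ ≡ c mod f₁`. […] `#{c₁ mod f₁ ∣ c₁² ≡ −d₁/t₁ mod 2f₁} = 2^{ρ(f₁/2)}`
[…] The rest is similar to the case (i). If `f₁` and `d₁` are both odd, then […] the number of solutions modulo `2f₁` is
equal to `2^{ρ(f₁)}` and they are all different modulo `f₁`. […] (iv) […] `B = g₁ (−2b/g₁, cwt₁; cwt₁, −w²f₁t₁)`. We have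
`(cwt₁, w²f₁t₁) = wt₁(c, wf₁) = wt₁`. The greatest common divisor of the elements of `B` is equal to `g₁(2b/g₁, w)` because
`2b/g₁` and `t₁` are coprime."

## Reading notes

* ABSTRACTION as in g41/g43/g44: everything is proved for `L = B₀ ⊕ ⟨−2t⟩` on `M × ℤ`, `B₀` symmetric even unimodular with two
  orthogonal hyperbolic pairs (`L_{2t}`: `B₀ = L_{K3}`), then for the models `(E₈(−1)^{⊕m} ⊕ U^{⊕(k+2)}) ⊕ ℤ(−2t)`. The number
  of `Õ(L)`-orbits is the number `N` of admissible classes `{c ∈ (ℤ/f)ˣ : f² ∣ d + c²t}` (row g43-#2); this file evaluates `N`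
  with NO hypothesis on `w`, "if at least one `h_d` exists" (one admissible `c₀` given). The existence criteria by quadratic
  residues are not restated (as in g44-#3).
* THE COUNT, relative to one solution. For an admissible `c₀`, `c ↦ u = c/c₀` identifies the admissible classes with the
  subgroup `R = {u ∈ (ℤ/f)ˣ : f² ∣ t(u² − 1)}` (§1–§2): the admissible classes are an `R`-torsor. With `w = (f, 2t/f)` — which
  for types that occur IS the printed `w = ((2t/f, 2d/f), f)` (`gcd_gcd_eq_gcd_of_sq_dvd`, `w_eq_gcd_of_divisor`) — and
  `f = wf₁`, `2t/f = wT₁` (`T₁ = g₁t₁`), `(f₁, T₁) = 1`: `f² ∣ t(u² − 1) ⟺ 2f₁ ∣ T₁(u² − 1)`, which is `f₁ ∣ u² − 1` when `f₁`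
  is odd and `2f₁ ∣ u² − 1` when `f₁` is even (§1). Hence `R` is the preimage under the reduction `(ℤ/f)ˣ ↠ (ℤ/f₁)ˣ` of the
  square roots of `1` modulo `f₁` (`2^{ρ(f₁)}` of them, `f₁` odd) resp. of `{v mod f₁ : v² ≡ 1 (mod 2f₁)}` (`2^{ρ(f₁/2)}` of
  them, `f₁` even), and the fibres of the reduction have `φ(f)/φ(f₁)` elements — this is the printed count "for any fixed `c₁`
  there are exactly `w₊(f₁)φ(w₋(f₁))` solutions `c` modulo `f`", because `φ(wf₁) = w₊(f₁)·φ(w₋(f₁))·φ(f₁)` (§2,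
  `totient_mul_eq_wPlus_mul_totient_wMinus_mul_totient`, with `w₊(f₁) = ∏_{p ∣ w, p ∣ f₁} p^{v_p(w)}` "the product of all powers
  of primes dividing `(w, f₁)`" and `w₋(f₁) = w/w₊(f₁) = ∏_{p ∣ w, p ∤ f₁} p^{v_p(w)}`).
* THE THREE PRINTED CASES therefore collapse to the parity of `f₁`: `N = w₊(f₁)φ(w₋(f₁)) · 2^{ρ(f₁)}` when `f₁` is odd (case
  (i), where `g₁` even forces `f₁` odd; case (ii) with `f₁ ≡ d₁ ≡ 1 mod 2`; case (iii)) and `N = w₊(f₁)φ(w₋(f₁)) · 2^{ρ(f₁/2)}`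
  when `f₁` is even (case (ii), `f₁ ≡ 0 mod 2`). Both are stated division-free as `N · φ(f₁) = φ(f) · 2^{ρ}` (§3) and in the
  printed product form; the case `w = 1` (`f₁ = f`, row g44-#3) is recovered.
* CASE (iii) DOES NOT OCCUR (§7, `odd_of_admissible_of_odd_of_odd`): for an actual polarisation type with `g₁` and `f₁` odd,
  `d₁` is odd — `2t = w²f₁g₁t₁` with `f₁g₁t₁` odd forces `w` even, while an even `d₁` would force `c` even; this is consistent
  with the printed criterion of (iii), whose condition "`w` is odd" then fails, so the printed biconditional holds vacuously.
  Recorded as a reading note; nothing is restated as an erratum.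
* (iv): the tree (g43-#2) has `h^⊥ ≅ (E₈(−1)^{⊕m} ⊕ U^{⊕(k+1)}) ⊕ B`, `B = (−2b, a; a, −2t)` with `f²b = d + c²t`, `fa = 2tc`
  for EVERY primitive `h` with `(h, L) = fℤ` (`c = h.2`), and `det B · f² = 4dt`; §6 adds the printed last sentence
  `gcd(2b, a, 2t) = g₁ · (2b/g₁, w)` as an identity of natural numbers (`g = (2t/f, 2d/f)`, `w = (g, f)`, `g₁ = g/w`), by the
  printed argument (`2f₁b = g₁(d₁ + t₁c²)`, `(cwt₁, w²f₁t₁) = wt₁(c, wf₁) = wt₁`, "`2b/g₁` and `t₁` are coprime").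
* Numerics first (session folder `num/check46.py`): brute force over `t ≤ 60`, all `(d, f)` with an admissible class (9 995
  cases): `N · φ(f₁) = φ(f) · 2^{ρ(f₁)}` / `· 2^{ρ(f₁/2)}`, the printed `w₊φ(w₋)` form, the vacuity of (iii) and the gcd of (iv):
  0 mismatches.

## Contents (all proved)

* §1 relative arithmetic: `sq_dvd_add_mul_sq_iff_sq_dvd_mul_sq_sub_sq` (`f² ∣ d + c²t ⟺ f² ∣ t(c² − c₀²)`),
  `sq_dvd_mul_sq_sub_iff_of_dvd_sub` (depends on `c mod f`), `sq_dvd_mul_mul_sq_sub_sq_iff` (`u = c/c₀`),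
  **`gcd_gcd_eq_gcd_of_sq_dvd`** (`((2t/f, 2d/f), f) = (f, 2t/f)`), `sq_dvd_mul_iff_two_mul_dvd_mul` (`f² ∣ ty ⟺ 2f₁ ∣ T₁y`),
  **`sq_dvd_mul_sq_sub_one_iff_of_odd`** (`f₁` odd: `⟺ f₁ ∣ u² − 1`), **`sq_dvd_mul_sq_sub_one_iff_of_even`** (`f₁` even:
  `⟺ 2f₁ ∣ u² − 1`), `divisor_factorisation` (`w = (f, 2t/f)`, `f = wf₁`, `2t/f = wT₁`, `(f₁, T₁) = 1`).
* §2 counting: **`natCard_unitsMap_fibre_mul_totient`** ("exactly `w₊(f₁)φ(w₋(f₁))` solutions `c` with `c ≡ c₁ mod f₁`,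
  `(c, f) = 1`": `#fibre · φ(f₁) = φ(f)`), **`totient_mul_eq_wPlus_mul_totient_wMinus_mul_totient`**
  (`w = w₊w₋`, `φ(wf₁) = w₊φ(w₋)φ(f₁)`), **`natCard_units_sq_dvd_mul_totient_of_odd`** / **`_of_even`** (`#R · φ(f₁) = φ(f) · 2^ρ`),
  **`natCard_admissible_eq_natCard_units_sq_dvd`** (the torsor: `#admissible = #R`).
* §3 Prop. 4.6 (i)–(iii) for the admissible classes: **`natCard_admissible_mul_totient_of_odd`** / **`_of_even`**
  (`N · φ(f₁) = φ(f) · 2^{ρ(f₁)}` / `φ(f) · 2^{ρ(f₁/2)}`), the printed form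
  **`natCard_admissible_eq_wPlus_mul_totient_wMinus_mul_two_pow_of_odd`** / **`_of_even`** (`N = w₊(f₁)φ(w₋(f₁)) · 2^ρ`), and the
  closed form in `f`, `t` alone `natCard_admissible_mul_totient_div_gcd_of_odd` / `_of_even` (`f₁ = f/(f, 2t/f)`).
* §4 `L = B₀ ⊕ ⟨−2t⟩` (`B₀` even unimodular, two orthogonal hyperbolic pairs, `t ≥ 1`): `divisor_data` (no `w` hypothesis),
  **`w_eq_gcd_of_divisor`**, and the number of `Õ(L)`-orbits of primitive `h` with `h² = 2d`, `(h, L) = fℤ` (one exists):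
  **`natCard_quot_stable_isometryEquiv_two_mul_of_divisor_mul_totient_of_odd`** / **`_of_even`**, the printed form
  **`natCard_quot_stable_isometryEquiv_two_mul_of_divisor_eq_wPlus_mul_of_odd`** / **`_of_even`**, and the closed form
  `…_mul_totient_div_gcd_of_odd` / `_of_even`.
* §5 the same for the models `(E₈(−1)^{⊕m} ⊕ U^{⊕(k+2)}) ⊕ ℤ(−2t)` (`…_model_…`).
* §6 Prop. 4.6 (iv), last sentence: **`gcd_entries_generalDivisorGram`** (`gcd(2b, a, 2t) = g₁ · (2b/g₁, w)`) and, for a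
  polarisation vector of `L`, `gcd_entries_of_divisor`.
* §7 reading note: `odd_of_admissible_of_odd_of_odd` (case (iii) never occurs).

## References

* [GritsenkoHulekSankaran2010Symplectic] V. Gritsenko, K. Hulek, G. K. Sankaran, Moduli spaces of irreducible symplectic
  manifolds, Compositio Math. 146 (2010) 404–434 (arXiv:0802.2078): §4 Prop. 4.6 (i)–(iv) and proof.
* [GritsenkoHulekSankaran2007HM] V. Gritsenko, K. Hulek, G. K. Sankaran, The Hirzebruch–Mumford volume for the orthogonal
  group and applications, Doc. Math. 12 (2007): §4 proof of Lemma 4.3 (`#{x mod 2d : x² ≡ 1 mod 4d} = 2^{ρ(d)}`).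
* [GritsenkoHulekSankaran2009] V. Gritsenko, K. Hulek, G. K. Sankaran, Abelianisation of orthogonal groups and the
  fundamental group of modular varieties, J. Algebra 322 (2009): Prop. 3.3 (i) (Eichler criterion, behind row g43-#2).
-/

noncomputable section

open Module Function
open LinearMap (BilinForm)
open LinearMap.BilinForm

namespace Literature.Topology.FourManifolds

universe u

/-! ### §1 Relative arithmetic: `f² ∣ d + c²t` read against one admissible `c₀` -/

section Arithmetic

/-- **`f² ∣ d + c²t ⟺ f² ∣ t(c² − c₀²)`** once `f² ∣ d + c₀²t` — the congruences (c1-cong0)/(c1-cong1) of the printed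
proof read relative to one solution `c₀`. [cite: GritsenkoHulekSankaran2010Symplectic, §4 proof of Prop. 4.6 (displays (c-eq), (c1-cong0))] -/
theorem sq_dvd_add_mul_sq_iff_sq_dvd_mul_sq_sub_sq {f t d c₀ : ℤ} (h₀ : f ^ 2 ∣ d + t * c₀ ^ 2) (c : ℤ) :
    f ^ 2 ∣ d + t * c ^ 2 ↔ f ^ 2 ∣ t * (c ^ 2 - c₀ ^ 2) := by
  have e : d + t * c ^ 2 = (d + t * c₀ ^ 2) + t * (c ^ 2 - c₀ ^ 2) := by ring
  rw [e]
  exact dvd_add_right h₀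

/-- **`f² ∣ t(x² − a)` depends only on `x mod f` when `f ∣ 2t`**: `t((x + kf)² − x²) = f²(k·(2t/f)·… ) ∈ f²ℤ`
("`c` is taken modulo `f`"). [cite: GritsenkoHulekSankaran2010Symplectic, §4 proof of Prop. 4.6 ("determined by `c` mod `f`")] -/
theorem sq_dvd_mul_sq_sub_iff_of_dvd_sub {f t a x y : ℤ} (hft : f ∣ 2 * t) (hxy : f ∣ x - y) :
    f ^ 2 ∣ t * (x ^ 2 - a) ↔ f ^ 2 ∣ t * (y ^ 2 - a) := by
  obtain ⟨m, hm⟩ := hft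
  obtain ⟨k, hk⟩ := hxy
  have hx : x = y + f * k := by linear_combination hk
  have e : t * (x ^ 2 - a) = f ^ 2 * (m * y * k + t * k ^ 2) + t * (y ^ 2 - a) := by
    rw [hx]; linear_combination (y * k * f) * hm
  rw [e]
  exact dvd_add_right (dvd_mul_right _ _)

/-- **`u = c/c₀`**: for `c₀` coprime to `f`, `f² ∣ t((uc₀)² − c₀²) ⟺ f² ∣ t(u² − 1)` — "any solution `c₁` is coprime to
`f₁`", so the admissible classes form a torsor under `{u mod f : f² ∣ t(u² − 1)}`.
[cite: GritsenkoHulekSankaran2010Symplectic, §4 proof of Prop. 4.6 (i) ("`#{x mod f₁ ∣ x² ≡ 1 mod f₁}`")] -/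
theorem sq_dvd_mul_mul_sq_sub_sq_iff {f t c₀ u : ℤ} (hc₀ : Int.gcd f c₀ = 1) :
    f ^ 2 ∣ t * ((u * c₀) ^ 2 - c₀ ^ 2) ↔ f ^ 2 ∣ t * (u ^ 2 - 1) := by
  have e : t * ((u * c₀) ^ 2 - c₀ ^ 2) = t * (u ^ 2 - 1) * c₀ ^ 2 := by ring
  rw [e]
  refine ⟨fun h ↦ ?_, fun h ↦ h.mul_right _⟩
  have hcop : IsCoprime (f ^ 2) (c₀ ^ 2) := (Int.isCoprime_iff_gcd_eq_one.2 hc₀).pow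
  exact hcop.dvd_of_dvd_mul_right h

/-- **For types that occur, `w = ((2t/f, 2d/f), f) = (f, 2t/f)`**: with `2t = fm`, `2d = fe` and one admissible `c`
(`f² ∣ d + c²t`, so that `f ∣ e + mc²` — display (c-eq)), `((m, e), f) = (f, m)`.
[cite: GritsenkoHulekSankaran2010Symplectic, §4 Prop. 4.6 ("`g = (2t/f, 2d/f)`, `w = (g, f)`") and proof (display (c-eq))] -/
theorem gcd_gcd_eq_gcd_of_sq_dvd {f m e t d c : ℤ} (hf0 : f ≠ 0) (hm : 2 * t = f * m) (he : 2 * d = f * e)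
    (h : f ^ 2 ∣ d + t * c ^ 2) : Int.gcd (Int.gcd m e : ℤ) f = Int.gcd f m := by
  have hq : f ∣ e + m * c ^ 2 := dvd_add_mul_sq_of_sq_dvd hf0 hm he h
  apply Nat.dvd_antisymm
  · -- `((m, e), f) ∣ f` and `∣ m`
    apply Int.natCast_dvd_natCast.1
    exact Int.dvd_coe_gcd (Int.gcd_dvd_right _ _) ((Int.gcd_dvd_left _ _).trans (Int.gcd_dvd_left _ _))
  · -- `(f, m) ∣ e = (e + mc²) − mc²`
    apply Int.natCast_dvd_natCast.1
    have hf' : (Int.gcd f m : ℤ) ∣ f := Int.gcd_dvd_left _ _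
    have hm' : (Int.gcd f m : ℤ) ∣ m := Int.gcd_dvd_right _ _
    have he' : (Int.gcd f m : ℤ) ∣ e := by
      have ee : e = (e + m * c ^ 2) - m * c ^ 2 := by ring
      rw [ee]
      exact dvd_sub (hf'.trans hq) (hm'.mul_right _)
    exact Int.dvd_coe_gcd (Int.dvd_coe_gcd hm' he') hf'

/-- **`2f₁ ∣ T₁·y ⟺ f² ∣ t·y`** where `w = (f, 2t/f)`, `f = wf₁`, `2t/f = wT₁` — the passage "`2f₁b = g₁(d₁ + c²t₁)`" from
`f²`-divisibility to a congruence modulo `f₁` resp. `2f₁` (here `T₁ = g₁t₁`). [cite: GritsenkoHulekSankaran2010Symplectic, §4 proof of Prop. 4.6 (display (c-eq))] -/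
theorem sq_dvd_mul_iff_two_mul_dvd_mul {f w f₁ T₁ t : ℕ} (hf0 : f ≠ 0) (hf : f = w * f₁) (hT : 2 * t = f * (w * T₁))
    (y : ℤ) : (f : ℤ) ^ 2 ∣ t * y ↔ (2 * f₁ : ℤ) ∣ T₁ * y := by
  have hw0 : (w : ℤ) ≠ 0 := by
    rintro hw
    apply hf0
    rw [hf]
    exact_mod_cast (show (w : ℤ) * f₁ = 0 by rw [hw, zero_mul])
  have hf0' : (f : ℤ) ≠ 0 := by exact_mod_cast hf0
  have hT' : (2 * t : ℤ) = f * (w * T₁) := by exact_mod_cast hT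
  calc (f : ℤ) ^ 2 ∣ t * y ↔ 2 * (f : ℤ) ^ 2 ∣ 2 * (t * y) := (mul_dvd_mul_iff_left two_ne_zero).symm
    _ ↔ (f : ℤ) * (2 * f) ∣ f * (w * T₁ * y) := by
        rw [show 2 * ((t : ℤ) * y) = f * (w * T₁ * y) by linear_combination y * hT',
          show 2 * (f : ℤ) ^ 2 = f * (2 * f) by ring]
    _ ↔ (2 * f : ℤ) ∣ w * T₁ * y := mul_dvd_mul_iff_left hf0'
    _ ↔ (w : ℤ) * (2 * f₁) ∣ w * (T₁ * y) := by
        rw [show (2 * f : ℤ) = w * (2 * f₁) by rw [hf]; push_cast; ring, mul_assoc]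
    _ ↔ (2 * f₁ : ℤ) ∣ T₁ * y := mul_dvd_mul_iff_left hw0

/-- `w` is even when `f₁T₁` is odd: `2t = f·(2t/f) = w²·f₁T₁`. [folklore] -/
private theorem even_w_of_odd {f w f₁ T₁ t : ℕ} (hf : f = w * f₁) (hT : 2 * t = f * (w * T₁)) (hodd : Odd (f₁ * T₁)) :
    Even w := by
  have h2 : Even (w * w * (f₁ * T₁)) := ⟨t, by rw [← two_mul, hT, hf]; ring⟩
  rcases Nat.even_mul.1 h2 with h | h
  · rcases Nat.even_mul.1 h with h | h <;> exact h
  · exact absurd h (Nat.not_even_iff_odd.2 hodd)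

/-- **`f₁` odd: `f² ∣ t(x² − 1) ⟺ f₁ ∣ x² − 1`** for `x` coprime to `f` (`w = (f, 2t/f)`, `f = wf₁`, `2t/f = wT₁`,
`(f₁, T₁) = 1`) — the printed reductions to "`t₁c₁² ≡ −d₁ mod f₁`" (case (i), `g₁` even) and to the congruence modulo
`2f₁` with `f₁`, `d₁` odd (case (ii), second half), read relative to one solution.
[cite: GritsenkoHulekSankaran2010Symplectic, §4 proof of Prop. 4.6 (i), (ii) (displays (c1-cong0), (c1-cong1))] -/
theorem sq_dvd_mul_sq_sub_one_iff_of_odd {f w f₁ T₁ t : ℕ} (hf0 : f ≠ 0) (hf : f = w * f₁) (hT : 2 * t = f * (w * T₁))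
    (hcop : Nat.Coprime f₁ T₁) (hodd : Odd f₁) {x : ℤ} (hx : Int.gcd (f : ℤ) x = 1) :
    (f : ℤ) ^ 2 ∣ t * (x ^ 2 - 1) ↔ (f₁ : ℤ) ∣ x ^ 2 - 1 := by
  rw [sq_dvd_mul_iff_two_mul_dvd_mul hf0 hf hT]
  have hcopZ : IsCoprime (f₁ : ℤ) (T₁ : ℤ) := Nat.isCoprime_iff_coprime.2 hcop
  constructor
  · intro h
    exact hcopZ.dvd_of_dvd_mul_left ((dvd_mul_left (f₁ : ℤ) 2).trans h)
  · intro h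
    -- `2 ∣ T₁(x² − 1)`: either `T₁` is even, or `w` is even, `f` is even, `x` is odd
    have h2 : (2 : ℤ) ∣ T₁ * (x ^ 2 - 1) := by
      rcases Nat.even_or_odd T₁ with hT₁ | hT₁
      · have h2T : (2 : ℤ) ∣ (T₁ : ℤ) := by exact_mod_cast even_iff_two_dvd.1 hT₁
        exact h2T.mul_right _
      · have hw : Even w := even_w_of_odd hf hT (hodd.mul hT₁)
        have hfe : (2 : ℤ) ∣ f := by
          obtain ⟨k, hk⟩ := hw
          exact ⟨k * f₁, by rw [hf, hk]; push_cast; ring⟩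
        have hxo : Odd x := by
          rcases Int.even_or_odd x with hxe | hxo
          · exfalso
            have h1 : (2 : ℤ) ∣ (Int.gcd (f : ℤ) x : ℤ) := Int.dvd_coe_gcd hfe (even_iff_two_dvd.1 hxe)
            rw [hx] at h1
            norm_num at h1
          · exact hxo
        have hev : Even (x ^ 2 - 1) := by
          rw [show x ^ 2 - 1 = (x - 1) * (x + 1) by ring]
          exact (hxo.sub_odd odd_one).mul_right _
        exact (even_iff_two_dvd.1 hev).mul_left _
    have h2f : IsCoprime (2 : ℤ) (f₁ : ℤ) := by
      obtain ⟨k, hk⟩ := hodd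
      exact ⟨-(k : ℤ), 1, by rw [hk]; push_cast; ring⟩
    exact h2f.mul_dvd h2 (h.mul_left _)

/-- **`f₁` even: `f² ∣ t(x² − 1) ⟺ 2f₁ ∣ x² − 1`** (`w = (f, 2t/f)`, `f = wf₁`, `2t/f = wT₁`, `(f₁, T₁) = 1`, so `T₁` is
odd) — the printed reduction "`t₁c₁² ≡ −d₁ mod 2f₁`" of case (ii), `f₁ ≡ 0 mod 2`, read relative to one solution.
[cite: GritsenkoHulekSankaran2010Symplectic, §4 proof of Prop. 4.6 (ii) (display (c1-cong1))] -/
theorem sq_dvd_mul_sq_sub_one_iff_of_even {f w f₁ T₁ t : ℕ} (hf0 : f ≠ 0) (hf : f = w * f₁) (hT : 2 * t = f * (w * T₁))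
    (hcop : Nat.Coprime f₁ T₁) (heven : Even f₁) (x : ℤ) :
    (f : ℤ) ^ 2 ∣ t * (x ^ 2 - 1) ↔ (2 * f₁ : ℤ) ∣ x ^ 2 - 1 := by
  rw [sq_dvd_mul_iff_two_mul_dvd_mul hf0 hf hT]
  have hT₁ : Odd T₁ := by
    rcases Nat.even_or_odd T₁ with hT₁ | hT₁
    · exfalso
      have h2 : 2 ∣ Nat.gcd f₁ T₁ := Nat.dvd_gcd (even_iff_two_dvd.1 heven) (even_iff_two_dvd.1 hT₁)
      rw [hcop] at h2
      norm_num at h2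
    · exact hT₁
  have hcopZ : IsCoprime (2 * f₁ : ℤ) (T₁ : ℤ) := by
    refine IsCoprime.mul_left ?_ (Nat.isCoprime_iff_coprime.2 hcop)
    obtain ⟨k, hk⟩ := hT₁
    exact ⟨-(k : ℤ), 1, by rw [hk]; push_cast; ring⟩
  exact ⟨fun h ↦ hcopZ.dvd_of_dvd_mul_left h, fun h ↦ h.mul_left _⟩

/-- The factorisation `f = w f₁`, `2t/f = w T₁`, `(f₁, T₁) = 1` with `w = (f, 2t/f)`, for every `f ∣ 2t`, `f ≠ 0`.
[cite: GritsenkoHulekSankaran2010Symplectic, §4 Prop. 4.6 ("we put `g = wg₁`, `f = wf₁`")] -/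
theorem divisor_factorisation {f t : ℕ} (hf0 : f ≠ 0) (hft : (f : ℤ) ∣ 2 * t) :
    f = Nat.gcd f (2 * t / f) * (f / Nat.gcd f (2 * t / f)) ∧
      2 * t = f * (Nat.gcd f (2 * t / f) * (2 * t / f / Nat.gcd f (2 * t / f))) ∧
      Nat.Coprime (f / Nat.gcd f (2 * t / f)) (2 * t / f / Nat.gcd f (2 * t / f)) := by
  have hft' : f ∣ 2 * t := by exact_mod_cast hft
  refine ⟨(Nat.mul_div_cancel' (Nat.gcd_dvd_left _ _)).symm, ?_, ?_⟩
  · rw [Nat.mul_div_cancel' (Nat.gcd_dvd_right _ _), Nat.mul_div_cancel' hft']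
  · exact Nat.coprime_div_gcd_div_gcd (Nat.gcd_pos_of_pos_left _ (Nat.pos_of_ne_zero hf0))

end Arithmetic

/-! ### §2 Counting: fibres of `(ℤ/f)ˣ → (ℤ/f₁)ˣ`, the subgroup `{u : f² ∣ t(u² − 1)}`, and `φ(wf₁) = w₊φ(w₋)φ(f₁)` -/

section Fibre

/-- For a surjective homomorphism `π : G → H` of finite groups and a predicate `P` on `H`:
`#{g : P(πg)} · #H = #G · #{h : P(h)}` — all fibres of `π` have the same number of elements. [folklore] -/
private theorem card_subtype_comp_mul_card {G H : Type*} [Group G] [Group H] [Fintype G] [Fintype H] [DecidableEq H]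
    (π : G →* H) (hπ : Function.Surjective π) (P : H → Prop) [DecidablePred P] :
    Fintype.card {g // P (π g)} * Fintype.card H = Fintype.card G * Fintype.card {h // P h} := by
  classical
  set k := (Finset.univ.filter fun g : G ↦ π g = 1).card with hk
  have hfib : ∀ h : H, (Finset.univ.filter fun g : G ↦ π g = h).card = k := fun h ↦
    MonoidHom.card_fiber_eq_of_mem_range π (Set.mem_range.2 (hπ h)) (Set.mem_range.2 ⟨1, map_one π⟩)
  have hG : Fintype.card G = Fintype.card H * k := by
    rw [← Finset.card_univ, Finset.card_eq_sum_card_fiberwise (f := π) (s := Finset.univ) (t := Finset.univ)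
      (fun _ _ ↦ Finset.mem_coe.2 (Finset.mem_univ _)), Finset.sum_congr rfl fun h _ ↦ hfib h, Finset.sum_const,
      smul_eq_mul, Finset.card_univ]
  have hP : Fintype.card {g // P (π g)} = Fintype.card {h // P h} * k := by
    rw [Fintype.card_subtype, Fintype.card_subtype,
      Finset.card_eq_sum_card_fiberwise (f := π) (s := Finset.univ.filter fun g ↦ P (π g))
        (t := Finset.univ.filter P) ?_]
    · have hb : ∀ b ∈ Finset.univ.filter P,
          ((Finset.univ.filter fun g : G ↦ P (π g)).filter fun g ↦ π g = b).card = k := by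
        intro b hb
        rw [Finset.mem_filter] at hb
        rw [Finset.filter_filter, ← hfib b]
        congr 1
        ext g
        simp only [Finset.mem_filter, Finset.mem_univ, true_and]
        exact ⟨fun h ↦ h.2, fun h ↦ ⟨h ▸ hb.2, h⟩⟩
      rw [Finset.sum_congr rfl hb, Finset.sum_const, smul_eq_mul]
    · intro g hg
      rw [Finset.coe_filter, Set.mem_setOf_eq] at hg
      exact Finset.mem_coe.2 (Finset.mem_filter.2 ⟨Finset.mem_univ _, hg.2⟩)
  rw [hP, hG]
  ring

/-- **"For any fixed `c₁` there are exactly `w₊(f₁)φ(w₋(f₁))` solutions `c` modulo `f = f₁w` such that `c ≡ c₁ mod f₁`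
and `(c, f) = 1`"** — as the fibre count of the reduction `(ℤ/f)ˣ → (ℤ/f₁)ˣ`: `#{c ∈ (ℤ/f)ˣ : c ≡ c₁ (mod f₁)} · φ(f₁) = φ(f)`
(and `φ(f) = w₊(f₁)φ(w₋(f₁))φ(f₁)`, `totient_mul_eq_wPlus_mul_totient_wMinus_mul_totient`).
[cite: GritsenkoHulekSankaran2010Symplectic, §4 proof of Prop. 4.6 (i) ("there are exactly `w₊(f₁)φ(w₋(f₁))` solutions")] -/
theorem natCard_unitsMap_fibre_mul_totient {f f₁ : ℕ} [NeZero f] (hdvd : f₁ ∣ f) (c₁ : (ZMod f₁)ˣ) :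
    Nat.card {c : (ZMod f)ˣ // ZMod.unitsMap hdvd c = c₁} * Nat.totient f₁ = Nat.totient f := by
  classical
  haveI : NeZero f₁ := ⟨fun h ↦ NeZero.ne f (Nat.eq_zero_of_zero_dvd (h ▸ hdvd))⟩
  have h := card_subtype_comp_mul_card (ZMod.unitsMap hdvd) (ZMod.unitsMap_surjective hdvd) (· = c₁)
  rw [ZMod.card_units_eq_totient, ZMod.card_units_eq_totient, Fintype.card_subtype_eq, mul_one] at h
  rw [Nat.card_eq_fintype_card]
  exact h

/-- `φ(ab) = a·φ(b)` when every prime factor of `a` divides `b`. [folklore] -/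
private theorem totient_mul_of_primeFactors_subset :
    ∀ {a b : ℕ}, b ≠ 0 → a.primeFactors ⊆ b.primeFactors → Nat.totient (a * b) = a * Nat.totient b := by
  intro a
  induction a using Nat.strong_induction_on with
  | _ a ih =>
    intro b hb hab
    rcases Nat.eq_zero_or_pos a with rfl | ha0
    · simp
    rcases eq_or_ne a 1 with rfl | ha1
    · simp
    -- `a = p · a'` with `p ∣ b`
    have hp : a.minFac.Prime := Nat.minFac_prime ha1
    have hpa : a.minFac ∣ a := Nat.minFac_dvd a
    have hpb : a.minFac ∣ b :=
      Nat.dvd_of_mem_primeFactors (hab (Nat.mem_primeFactors.2 ⟨hp, hpa, ha0.ne'⟩))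
    obtain ⟨a', ha'⟩ := hpa
    have ha'0 : a' ≠ 0 := fun h ↦ by rw [h, mul_zero] at ha'; omega
    have ha'lt : a' < a := by
      rw [ha']
      exact lt_mul_left (Nat.pos_of_ne_zero ha'0) hp.one_lt
    have ha'sub : a'.primeFactors ⊆ b.primeFactors :=
      (Nat.primeFactors_mono ⟨a.minFac, ha'.trans (mul_comm _ _)⟩ ha0.ne').trans hab
    rw [ha', mul_assoc, Nat.totient_mul_of_prime_of_dvd hp (hpb.mul_left _), ih a' ha'lt hb ha'sub, mul_assoc]

/-- **`w = w₊(f₁)w₋(f₁)` and `φ(wf₁) = w₊(f₁)·φ(w₋(f₁))·φ(f₁)`**, "where `w₊(f₁)` is the product of all powers of primes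
dividing `(w, f₁)`" and `w₋(f₁) = w/w₊(f₁)`: here `w₊ = ∏_{p ∣ w, p ∣ f₁} p^{v_p(w)}` and `w₋ = ∏_{p ∣ w, p ∤ f₁} p^{v_p(w)}`.
(The identity behind "`w₊(f₁)φ(w₋(f₁))` solutions `c` modulo `f = f₁w`": `φ(f)/φ(f₁) = w₊φ(w₋)`.)
[cite: GritsenkoHulekSankaran2010Symplectic, §4 Prop. 4.6 (i) and proof of (i)] -/
theorem totient_mul_eq_wPlus_mul_totient_wMinus_mul_totient {w f₁ : ℕ} (hw : w ≠ 0) (hf₁ : f₁ ≠ 0) :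
    w = (∏ p ∈ w.primeFactors with p ∣ f₁, p ^ w.factorization p) *
        ∏ p ∈ w.primeFactors with ¬p ∣ f₁, p ^ w.factorization p ∧
      Nat.totient (w * f₁) = (∏ p ∈ w.primeFactors with p ∣ f₁, p ^ w.factorization p) *
        Nat.totient (∏ p ∈ w.primeFactors with ¬p ∣ f₁, p ^ w.factorization p) * Nat.totient f₁ := by
  set wp := ∏ p ∈ w.primeFactors with p ∣ f₁, p ^ w.factorization p with hwp
  set wm := ∏ p ∈ w.primeFactors with ¬p ∣ f₁, p ^ w.factorization p with hwm
  have hsplit : w = wp * wm := by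
    rw [hwp, hwm, Finset.prod_filter_mul_prod_filter_not]
    exact (Nat.prod_factorization_pow_eq_self hw).symm
  have hwm_f₁ : Nat.Coprime wm f₁ := by
    refine Nat.Coprime.prod_left fun p hp ↦ ?_
    rw [Finset.mem_filter] at hp
    exact Nat.Coprime.pow_left _ (((Nat.prime_of_mem_primeFactors hp.1).coprime_iff_not_dvd).2 hp.2)
  have hwm_wp : Nat.Coprime wm wp := by
    refine Nat.Coprime.prod_left fun p hp ↦ Nat.Coprime.pow_left _ ?_
    refine Nat.Coprime.prod_right fun q hq ↦ Nat.Coprime.pow_right _ ?_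
    rw [Finset.mem_filter] at hp hq
    rw [Nat.coprime_primes (Nat.prime_of_mem_primeFactors hp.1) (Nat.prime_of_mem_primeFactors hq.1)]
    rintro rfl
    exact hp.2 hq.2
  have hwp_sub : wp.primeFactors ⊆ f₁.primeFactors := by
    intro p hp
    have hpp := Nat.prime_of_mem_primeFactors hp
    obtain ⟨q, hq, hpq⟩ := (hpp.prime.dvd_finsetProd_iff _).1 (Nat.dvd_of_mem_primeFactors hp)
    rw [Finset.mem_filter] at hq
    have hpq' : p = q := (Nat.prime_dvd_prime_iff_eq hpp (Nat.prime_of_mem_primeFactors hq.1)).1 (hpp.dvd_of_dvd_pow hpq)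
    subst hpq'
    exact Nat.mem_primeFactors.2 ⟨hpp, hq.2, hf₁⟩
  refine ⟨hsplit, ?_⟩
  rw [hsplit, show wp * wm * f₁ = wm * (wp * f₁) by ring, Nat.totient_mul (hwm_wp.mul_right hwm_f₁),
    totient_mul_of_primeFactors_subset hf₁ hwp_sub]
  ring

end Fibre

section Count

/-- `{u ∈ ℤ/f : u unit, Q u} ≃ {v ∈ (ℤ/f)ˣ : Q v}`. [folklore] -/
private theorem natCard_isUnit_and_eq {f : ℕ} (Q : ZMod f → Prop) :
    Nat.card {u : ZMod f // IsUnit u ∧ Q u} = Nat.card {v : (ZMod f)ˣ // Q (v : ZMod f)} :=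
  Nat.card_congr
    { toFun := fun u ↦ ⟨u.2.1.unit, by rw [IsUnit.unit_spec]; exact u.2.2⟩
      invFun := fun v ↦ ⟨(v.1 : ZMod f), v.1.isUnit, v.2⟩
      left_inv := fun u ↦ Subtype.ext u.2.1.unit_spec
      right_inv := fun v ↦ Subtype.ext (Units.ext v.1.isUnit.unit_spec) }

/-- The `l_t`-coordinate of a unit class is coprime to `f`. [folklore] -/
private theorem int_gcd_val_eq_one {f : ℕ} [NeZero f] (v : (ZMod f)ˣ) : Int.gcd (f : ℤ) ((v : ZMod f).val : ℤ) = 1 := by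
  rw [Int.gcd_natCast_natCast, Nat.gcd_comm]
  exact ZMod.val_coe_unit_coprime v

/-- The square roots of `1` in `ℤ/m` counted as units. [folklore] -/
private theorem natCard_units_sq_eq_one (m : ℕ) :
    Nat.card {h : (ZMod m)ˣ // (h : ZMod m) ^ 2 = 1} = Nat.card {y : ZMod m // y ^ 2 = 1} :=
  (natCard_isUnit_and_eq fun y : ZMod m ↦ y ^ 2 = 1).symm.trans
    (Nat.card_congr (Equiv.subtypeEquivRight fun y ↦
      ⟨fun h ↦ h.2, fun h ↦ ⟨IsUnit.of_mul_eq_one y (by rw [← sq]; exact h), h⟩⟩))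

/-- **`f₁` odd: `#{u ∈ (ℤ/f)ˣ : f² ∣ t(u² − 1)} · φ(f₁) = φ(f) · 2^{ρ(f₁)}`** (`w = (f, 2t/f)`, `f = wf₁`, `2t/f = wT₁`,
`(f₁, T₁) = 1`): the group of which the admissible classes are a torsor is the preimage of the square roots of `1` modulo
`f₁` ("`#{x mod f₁ ∣ x² ≡ 1 mod f₁} = 2^{ρ(f₁)}`") under `(ℤ/f)ˣ ↠ (ℤ/f₁)ˣ`, whose fibres have `φ(f)/φ(f₁) = w₊(f₁)φ(w₋(f₁))`
elements. [cite: GritsenkoHulekSankaran2010Symplectic, §4 proof of Prop. 4.6 (i)] -/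
theorem natCard_units_sq_dvd_mul_totient_of_odd {f w f₁ T₁ t : ℕ} (hf0 : f ≠ 0) (hf : f = w * f₁)
    (hT : 2 * t = f * (w * T₁)) (hcop : Nat.Coprime f₁ T₁) (hodd : Odd f₁) :
    Nat.card {u : ZMod f // IsUnit u ∧ (f : ℤ) ^ 2 ∣ t * ((u.val : ℤ) ^ 2 - 1)} * Nat.totient f₁ =
      Nat.totient f * 2 ^ f₁.primeFactors.card := by
  classical
  haveI : NeZero f := ⟨hf0⟩
  have hf₁0 : f₁ ≠ 0 := by rintro rfl; exact hf0 (by rw [hf, mul_zero])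
  haveI : NeZero f₁ := ⟨hf₁0⟩
  have hdvd : f₁ ∣ f := ⟨w, by rw [hf, mul_comm]⟩
  set π : (ZMod f)ˣ →* (ZMod f₁)ˣ := ZMod.unitsMap hdvd with hπ
  -- the condition on `v ∈ (ℤ/f)ˣ` is `(π v)² = 1`
  have key : ∀ v : (ZMod f)ˣ, (f : ℤ) ^ 2 ∣ t * ((((v : ZMod f).val : ℕ) : ℤ) ^ 2 - 1) ↔
      ((π v : (ZMod f₁)ˣ) : ZMod f₁) ^ 2 = 1 := fun v ↦ by
    rw [sq_dvd_mul_sq_sub_one_iff_of_odd hf0 hf hT hcop hodd (int_gcd_val_eq_one v),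
      ← ZMod.intCast_zmod_eq_zero_iff_dvd, Int.cast_sub, Int.cast_pow, Int.cast_one, Int.cast_natCast, sub_eq_zero,
      hπ, ZMod.unitsMap_val, ZMod.cast_eq_val]
  have e1 : Nat.card {u : ZMod f // IsUnit u ∧ (f : ℤ) ^ 2 ∣ t * ((u.val : ℤ) ^ 2 - 1)} =
      Nat.card {v : (ZMod f)ˣ // ((π v : (ZMod f₁)ˣ) : ZMod f₁) ^ 2 = 1} :=
    (natCard_isUnit_and_eq _).trans (Nat.card_congr (Equiv.subtypeEquivRight key))
  have h := card_subtype_comp_mul_card π (ZMod.unitsMap_surjective hdvd) (fun h : (ZMod f₁)ˣ ↦ (h : ZMod f₁) ^ 2 = 1)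
  rw [ZMod.card_units_eq_totient, ZMod.card_units_eq_totient, ← Nat.card_eq_fintype_card, ← Nat.card_eq_fintype_card,
    natCard_units_sq_eq_one, natCard_sq_eq_one_zmod_of_odd hodd] at h
  rw [e1, h]

/-- `2n ∣ x − y ⟹ (4n ∣ x² − 1 ⟺ 4n ∣ y² − 1)`. [folklore] -/
private theorem four_mul_dvd_sq_sub_one_iff_of_dvd_sub {n x y : ℤ} (h : 2 * n ∣ x - y) :
    4 * n ∣ x ^ 2 - 1 ↔ 4 * n ∣ y ^ 2 - 1 := by
  have e : x ^ 2 - 1 = (x ^ 2 - y ^ 2) + (y ^ 2 - 1) := by ring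
  rw [e]
  exact dvd_add_right (four_mul_dvd_sq_sub_sq_of_dvd_sub h)

/-- **`f₁ = 2n` even: `#{u ∈ (ℤ/f)ˣ : f² ∣ t(u² − 1)} · φ(2n) = φ(f) · 2^{ρ(n)}`** (`w = (f, 2t/f)`, `f = w·2n`, `2t/f = wT₁`,
`(2n, T₁) = 1`): the preimage under `(ℤ/f)ˣ ↠ (ℤ/2n)ˣ` of `{u mod 2n : u² ≡ 1 (mod 4n)}`
("`#{c₁ mod f₁ ∣ c₁² ≡ −d₁/t₁ mod 2f₁} = 2^{ρ(f₁/2)}`"). [cite: GritsenkoHulekSankaran2010Symplectic, §4 proof of Prop. 4.6 (ii)] [cite: GritsenkoHulekSankaran2007HM, §4 proof of Lemma 4.3] -/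
theorem natCard_units_sq_dvd_mul_totient_of_even {f w n T₁ t : ℕ} (hf0 : f ≠ 0) (hn : 0 < n) (hf : f = w * (2 * n))
    (hT : 2 * t = f * (w * T₁)) (hcop : Nat.Coprime (2 * n) T₁) :
    Nat.card {u : ZMod f // IsUnit u ∧ (f : ℤ) ^ 2 ∣ t * ((u.val : ℤ) ^ 2 - 1)} * Nat.totient (2 * n) =
      Nat.totient f * 2 ^ n.primeFactors.card := by
  classical
  haveI : NeZero f := ⟨hf0⟩
  haveI : NeZero (2 * n) := ⟨by omega⟩
  have hdvd : 2 * n ∣ f := ⟨w, by rw [hf, mul_comm]⟩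
  set π : (ZMod f)ˣ →* (ZMod (2 * n))ˣ := ZMod.unitsMap hdvd with hπ
  -- the condition on `v ∈ (ℤ/f)ˣ` is `4n ∣ (π v)² − 1` on the canonical lift
  have key : ∀ v : (ZMod f)ˣ, (f : ℤ) ^ 2 ∣ t * ((((v : ZMod f).val : ℕ) : ℤ) ^ 2 - 1) ↔
      (4 * n : ℤ) ∣ (((π v : (ZMod (2 * n))ˣ) : ZMod (2 * n)).val : ℤ) ^ 2 - 1 := fun v ↦ by
    rw [sq_dvd_mul_sq_sub_one_iff_of_even hf0 hf hT hcop (even_two_mul n), hπ, ZMod.unitsMap_val, ZMod.cast_eq_val,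
      ZMod.val_natCast]
    push_cast
    rw [show (2 * (2 * n) : ℤ) = 4 * n by ring]
    apply four_mul_dvd_sq_sub_one_iff_of_dvd_sub
    exact (Int.mod_modEq _ _).dvd
  have e1 : Nat.card {u : ZMod f // IsUnit u ∧ (f : ℤ) ^ 2 ∣ t * ((u.val : ℤ) ^ 2 - 1)} =
      Nat.card {v : (ZMod f)ˣ // (4 * n : ℤ) ∣ (((π v : (ZMod (2 * n))ˣ) : ZMod (2 * n)).val : ℤ) ^ 2 - 1} :=
    (natCard_isUnit_and_eq _).trans (Nat.card_congr (Equiv.subtypeEquivRight key))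
  have h := card_subtype_comp_mul_card π (ZMod.unitsMap_surjective hdvd)
    (fun h : (ZMod (2 * n))ˣ ↦ (4 * n : ℤ) ∣ ((h : ZMod (2 * n)).val : ℤ) ^ 2 - 1)
  -- `{u mod 2n : 4n ∣ u² − 1}` counted as units
  have hcast : ∀ c : ZMod (2 * n), ((c.val : ℤ) : ZMod (2 * n)) = c := fun c ↦ by
    rw [Int.cast_natCast, ZMod.natCast_zmod_val]
  have e2 : Nat.card {h : (ZMod (2 * n))ˣ // (4 * n : ℤ) ∣ ((h : ZMod (2 * n)).val : ℤ) ^ 2 - 1} =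
      Nat.card {u : ZMod (2 * n) // (4 * n : ℤ) ∣ (u.val : ℤ) ^ 2 - 1} := by
    refine (natCard_isUnit_and_eq fun u : ZMod (2 * n) ↦ (4 * n : ℤ) ∣ (u.val : ℤ) ^ 2 - 1).symm.trans
      (Nat.card_congr (Equiv.subtypeEquivRight fun u ↦ ⟨fun h ↦ h.2, fun h ↦ ⟨?_, h⟩⟩))
    have h1 : u ^ 2 = 1 := by
      have h2 : (2 * n : ℤ) ∣ (u.val : ℤ) ^ 2 - 1 := (Dvd.intro 2 (by ring)).trans h
      have h3 := (ZMod.intCast_eq_intCast_iff_dvd_sub 1 ((u.val : ℤ) ^ 2) (2 * n)).2 (by push_cast; exact h2)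
      rw [Int.cast_pow, hcast, Int.cast_one] at h3
      exact h3.symm
    exact IsUnit.of_mul_eq_one u (by rw [← sq]; exact h1)
  rw [ZMod.card_units_eq_totient, ZMod.card_units_eq_totient, ← Nat.card_eq_fintype_card, ← Nat.card_eq_fintype_card,
    e2, natCard_zmod_two_mul_sq_sub_one_dvd hn] at h
  rw [e1, h]

/-- **The admissible classes are a torsor: `#{c ∈ (ℤ/f)ˣ : f² ∣ d + c²t} = #{u ∈ (ℤ/f)ˣ : f² ∣ t(u² − 1)}`** as soon as one
admissible `c₀` exists (`f ∣ 2t`, `(f, c₀) = 1`, `f² ∣ d + c₀²t`), via `c ↦ c/c₀` — "the number of solutions […] is equal to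
`#{x mod f₁ ∣ x² ≡ 1 mod f₁}`", here before the reduction modulo `f₁`. [cite: GritsenkoHulekSankaran2010Symplectic, §4 proof of Prop. 4.6 (i), (ii)] -/
theorem natCard_admissible_eq_natCard_units_sq_dvd {t : ℕ} {d : ℤ} {f : ℕ} (hf0 : f ≠ 0) (hft : (f : ℤ) ∣ 2 * t)
    {c₀ : ℤ} (hc₀ : Int.gcd (f : ℤ) c₀ = 1) (hd₀ : (f : ℤ) ^ 2 ∣ d + t * c₀ ^ 2) :
    Nat.card {c : ZMod f // IsUnit c ∧ (f : ℤ) ^ 2 ∣ d + t * (c.val : ℤ) ^ 2} =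
      Nat.card {u : ZMod f // IsUnit u ∧ (f : ℤ) ^ 2 ∣ t * ((u.val : ℤ) ^ 2 - 1)} := by
  haveI : NeZero f := ⟨hf0⟩
  have hu0 : IsUnit ((c₀ : ℤ) : ZMod f) :=
    (ZMod.coe_int_isUnit_iff_isCoprime _ _).2 (Int.isCoprime_iff_gcd_eq_one.2 hc₀)
  set γ : (ZMod f)ˣ := hu0.unit with hγdef
  have hγ : (γ : ZMod f) = (c₀ : ZMod f) := hu0.unit_spec
  have hcast : ∀ c : ZMod f, ((c.val : ℤ) : ZMod f) = c := fun c ↦ by rw [Int.cast_natCast, ZMod.natCast_zmod_val]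
  -- `f ∣ c.val − (c/c₀).val · c₀`
  have hlift : ∀ c : ZMod f, (f : ℤ) ∣ (c.val : ℤ) - ((c * ↑γ⁻¹ : ZMod f).val : ℤ) * c₀ := fun c ↦ by
    apply (ZMod.intCast_eq_intCast_iff_dvd_sub _ _ f).1
    rw [Int.cast_mul, hcast, hcast, ← hγ, Units.inv_mul_cancel_right]
  have key : ∀ c : ZMod f, (f : ℤ) ^ 2 ∣ d + t * (c.val : ℤ) ^ 2 ↔
      (f : ℤ) ^ 2 ∣ t * (((c * ↑γ⁻¹ : ZMod f).val : ℤ) ^ 2 - 1) := fun c ↦ by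
    rw [sq_dvd_add_mul_sq_iff_sq_dvd_mul_sq_sub_sq hd₀, sq_dvd_mul_sq_sub_iff_of_dvd_sub hft (hlift c),
      sq_dvd_mul_mul_sq_sub_sq_iff hc₀]
  refine Nat.card_congr
    { toFun := fun c ↦ ⟨c.1 * ↑γ⁻¹, c.2.1.mul (γ⁻¹).isUnit, (key c.1).1 c.2.2⟩
      invFun := fun u ↦ ⟨u.1 * γ, u.2.1.mul γ.isUnit, (key _).2 ?_⟩
      left_inv := fun c ↦ Subtype.ext (Units.inv_mul_cancel_right _ _)
      right_inv := fun u ↦ Subtype.ext (Units.mul_inv_cancel_right _ _) }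
  rw [Units.mul_inv_cancel_right]
  exact u.2.2

end Count

/-! ### §3 Prop. 4.6 (i)–(iii): the number of admissible classes `c mod f` for a general `w` -/

section Admissible

/-- **Prop. 4.6 (i)–(iii), the count of the admissible classes for a general `w`, `f₁` odd**: with `w = (f, 2t/f)`,
`f = wf₁`, `2t/f = wT₁`, `(f₁, T₁) = 1` and one admissible `c₀` ((`c₀, f) = 1`, `f² ∣ d + c₀²t`):
`#{c mod f : (c, f) = 1, f² ∣ d + c²t} · φ(f₁) = φ(f) · 2^{ρ(f₁)}` — the printed "`w₊(f₁)φ(w₋(f₁)) · 2^{ρ(f₁)}`" of case (i)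
(`g₁` even), of case (ii) with "`f₁ ≡ d₁ ≡ 1 mod 2`", and of case (iii), because `φ(f) = w₊(f₁)φ(w₋(f₁))φ(f₁)`
(`totient_mul_eq_wPlus_mul_totient_wMinus_mul_totient`; printed form in
`natCard_admissible_eq_wPlus_mul_totient_wMinus_mul_two_pow_of_odd`).
[cite: GritsenkoHulekSankaran2010Symplectic, §4 Prop. 4.6 (i)–(iii) and proof] -/
theorem natCard_admissible_mul_totient_of_odd {t : ℕ} {d : ℤ} {f w f₁ T₁ : ℕ} (hf0 : f ≠ 0) (hf : f = w * f₁)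
    (hT : 2 * t = f * (w * T₁)) (hcop : Nat.Coprime f₁ T₁) (hodd : Odd f₁)
    {c₀ : ℤ} (hc₀ : Int.gcd (f : ℤ) c₀ = 1) (hd₀ : (f : ℤ) ^ 2 ∣ d + t * c₀ ^ 2) :
    Nat.card {c : ZMod f // IsUnit c ∧ (f : ℤ) ^ 2 ∣ d + t * (c.val : ℤ) ^ 2} * Nat.totient f₁ =
      Nat.totient f * 2 ^ f₁.primeFactors.card := by
  have hft : (f : ℤ) ∣ 2 * t := ⟨(w * T₁ : ℕ), by exact_mod_cast hT⟩
  rw [natCard_admissible_eq_natCard_units_sq_dvd hf0 hft hc₀ hd₀]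
  exact natCard_units_sq_dvd_mul_totient_of_odd hf0 hf hT hcop hodd

/-- **Prop. 4.6 (ii), the count of the admissible classes for a general `w`, `f₁ = 2n` even** ("`f₁ ≡ 0 mod 2`"): with
`w = (f, 2t/f)`, `f = w·2n`, `2t/f = wT₁`, `(2n, T₁) = 1` and one admissible `c₀`:
`#{c mod f : (c, f) = 1, f² ∣ d + c²t} · φ(2n) = φ(f) · 2^{ρ(n)}` — the printed "`w₊(f₁)φ(w₋(f₁)) · 2^{ρ(f₁/2)}`", because
`φ(f) = w₊(f₁)φ(w₋(f₁))φ(f₁)`. [cite: GritsenkoHulekSankaran2010Symplectic, §4 Prop. 4.6 (ii) and proof] -/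
theorem natCard_admissible_mul_totient_of_even {t : ℕ} {d : ℤ} {f w n T₁ : ℕ} (hf0 : f ≠ 0) (hn : 0 < n)
    (hf : f = w * (2 * n)) (hT : 2 * t = f * (w * T₁)) (hcop : Nat.Coprime (2 * n) T₁)
    {c₀ : ℤ} (hc₀ : Int.gcd (f : ℤ) c₀ = 1) (hd₀ : (f : ℤ) ^ 2 ∣ d + t * c₀ ^ 2) :
    Nat.card {c : ZMod f // IsUnit c ∧ (f : ℤ) ^ 2 ∣ d + t * (c.val : ℤ) ^ 2} * Nat.totient (2 * n) =
      Nat.totient f * 2 ^ n.primeFactors.card := by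
  have hft : (f : ℤ) ∣ 2 * t := ⟨(w * T₁ : ℕ), by exact_mod_cast hT⟩
  rw [natCard_admissible_eq_natCard_units_sq_dvd hf0 hft hc₀ hd₀]
  exact natCard_units_sq_dvd_mul_totient_of_even hf0 hn hf hT hcop

/-- **Prop. 4.6 (i)–(iii) in the printed form, `f₁` odd: `#{c mod f : (c, f) = 1, f² ∣ d + c²t} = w₊(f₁)φ(w₋(f₁)) · 2^{ρ(f₁)}`**
"if at least one `h_d` exists", where `w₊(f₁) = ∏_{p ∣ (w, f₁)} p^{v_p(w)}` "is the product of all powers of primes dividing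
`(w, f₁)`", `w₋(f₁) = w/w₊(f₁)`, "`ρ(n)` is the number of prime factors of `n` and `φ(n)` is the Euler function"
(`w = (f, 2t/f)`, `f = wf₁`, `2t/f = wT₁`, `(f₁, T₁) = 1`). [cite: GritsenkoHulekSankaran2010Symplectic, §4 Prop. 4.6 (i)–(iii)] -/
theorem natCard_admissible_eq_wPlus_mul_totient_wMinus_mul_two_pow_of_odd {t : ℕ} {d : ℤ} {f w f₁ T₁ : ℕ} (hf0 : f ≠ 0)
    (hf : f = w * f₁) (hT : 2 * t = f * (w * T₁)) (hcop : Nat.Coprime f₁ T₁) (hodd : Odd f₁)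
    {c₀ : ℤ} (hc₀ : Int.gcd (f : ℤ) c₀ = 1) (hd₀ : (f : ℤ) ^ 2 ∣ d + t * c₀ ^ 2) :
    Nat.card {c : ZMod f // IsUnit c ∧ (f : ℤ) ^ 2 ∣ d + t * (c.val : ℤ) ^ 2} =
      (∏ p ∈ w.primeFactors with p ∣ f₁, p ^ w.factorization p) *
        Nat.totient (∏ p ∈ w.primeFactors with ¬p ∣ f₁, p ^ w.factorization p) * 2 ^ f₁.primeFactors.card := by
  have h := natCard_admissible_mul_totient_of_odd hf0 hf hT hcop hodd hc₀ hd₀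
  have hw0 : w ≠ 0 := by rintro rfl; exact hf0 (by rw [hf, zero_mul])
  have hf₁0 : f₁ ≠ 0 := by rintro rfl; exact hf0 (by rw [hf, mul_zero])
  have hφ : Nat.totient f = (∏ p ∈ w.primeFactors with p ∣ f₁, p ^ w.factorization p) *
      Nat.totient (∏ p ∈ w.primeFactors with ¬p ∣ f₁, p ^ w.factorization p) * Nat.totient f₁ := by
    rw [hf]
    exact (totient_mul_eq_wPlus_mul_totient_wMinus_mul_totient hw0 hf₁0).2
  rw [hφ] at h
  apply Nat.eq_of_mul_eq_mul_right (Nat.totient_pos.2 (Nat.pos_of_ne_zero hf₁0))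
  rw [h]
  ring

/-- **Prop. 4.6 (ii) in the printed form, `f₁ = 2n` even: `#{c mod f : (c, f) = 1, f² ∣ d + c²t} = w₊(f₁)φ(w₋(f₁)) · 2^{ρ(f₁/2)}`**
"if `f₁ ≡ 0 mod 2`" (`w = (f, 2t/f)`, `f = wf₁`, `2t/f = wT₁`, `(f₁, T₁) = 1`, one admissible `c₀`).
[cite: GritsenkoHulekSankaran2010Symplectic, §4 Prop. 4.6 (ii)] -/
theorem natCard_admissible_eq_wPlus_mul_totient_wMinus_mul_two_pow_of_even {t : ℕ} {d : ℤ} {f w n T₁ : ℕ} (hf0 : f ≠ 0)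
    (hn : 0 < n) (hf : f = w * (2 * n)) (hT : 2 * t = f * (w * T₁)) (hcop : Nat.Coprime (2 * n) T₁)
    {c₀ : ℤ} (hc₀ : Int.gcd (f : ℤ) c₀ = 1) (hd₀ : (f : ℤ) ^ 2 ∣ d + t * c₀ ^ 2) :
    Nat.card {c : ZMod f // IsUnit c ∧ (f : ℤ) ^ 2 ∣ d + t * (c.val : ℤ) ^ 2} =
      (∏ p ∈ w.primeFactors with p ∣ 2 * n, p ^ w.factorization p) *
        Nat.totient (∏ p ∈ w.primeFactors with ¬p ∣ 2 * n, p ^ w.factorization p) * 2 ^ n.primeFactors.card := by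
  have h := natCard_admissible_mul_totient_of_even hf0 hn hf hT hcop hc₀ hd₀
  have hw0 : w ≠ 0 := by rintro rfl; exact hf0 (by rw [hf, zero_mul])
  have hn0 : 2 * n ≠ 0 := by omega
  have hφ : Nat.totient f = (∏ p ∈ w.primeFactors with p ∣ 2 * n, p ^ w.factorization p) *
      Nat.totient (∏ p ∈ w.primeFactors with ¬p ∣ 2 * n, p ^ w.factorization p) * Nat.totient (2 * n) := by
    rw [hf]
    exact (totient_mul_eq_wPlus_mul_totient_wMinus_mul_totient hw0 hn0).2
  rw [hφ] at h
  apply Nat.eq_of_mul_eq_mul_right (Nat.totient_pos.2 (Nat.pos_of_ne_zero hn0))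
  rw [h]
  ring

/-- **The count in closed form, `f/(f, 2t/f)` odd**: for `f ∣ 2t` and one admissible `c₀`,
`#{c mod f : (c, f) = 1, f² ∣ d + c²t} · φ(f₁) = φ(f) · 2^{ρ(f₁)}` with `f₁ = f/(f, 2t/f)`.
[cite: GritsenkoHulekSankaran2010Symplectic, §4 Prop. 4.6 (i)–(iii)] -/
theorem natCard_admissible_mul_totient_div_gcd_of_odd {t : ℕ} {d : ℤ} {f : ℕ} (hf0 : f ≠ 0) (hft : (f : ℤ) ∣ 2 * t)
    (hodd : Odd (f / Nat.gcd f (2 * t / f))) {c₀ : ℤ} (hc₀ : Int.gcd (f : ℤ) c₀ = 1)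
    (hd₀ : (f : ℤ) ^ 2 ∣ d + t * c₀ ^ 2) :
    Nat.card {c : ZMod f // IsUnit c ∧ (f : ℤ) ^ 2 ∣ d + t * (c.val : ℤ) ^ 2} * Nat.totient (f / Nat.gcd f (2 * t / f)) =
      Nat.totient f * 2 ^ (f / Nat.gcd f (2 * t / f)).primeFactors.card := by
  obtain ⟨hf, hT, hcop⟩ := divisor_factorisation hf0 hft
  exact natCard_admissible_mul_totient_of_odd hf0 hf hT hcop hodd hc₀ hd₀

/-- **The count in closed form, `f/(f, 2t/f)` even**: for `f ∣ 2t` and one admissible `c₀`,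
`#{c mod f : (c, f) = 1, f² ∣ d + c²t} · φ(f₁) = φ(f) · 2^{ρ(f₁/2)}` with `f₁ = f/(f, 2t/f)`.
[cite: GritsenkoHulekSankaran2010Symplectic, §4 Prop. 4.6 (ii)] -/
theorem natCard_admissible_mul_totient_div_gcd_of_even {t : ℕ} {d : ℤ} {f : ℕ} (hf0 : f ≠ 0) (hft : (f : ℤ) ∣ 2 * t)
    (heven : Even (f / Nat.gcd f (2 * t / f))) {c₀ : ℤ} (hc₀ : Int.gcd (f : ℤ) c₀ = 1)
    (hd₀ : (f : ℤ) ^ 2 ∣ d + t * c₀ ^ 2) :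
    Nat.card {c : ZMod f // IsUnit c ∧ (f : ℤ) ^ 2 ∣ d + t * (c.val : ℤ) ^ 2} * Nat.totient (f / Nat.gcd f (2 * t / f)) =
      Nat.totient f * 2 ^ (f / Nat.gcd f (2 * t / f) / 2).primeFactors.card := by
  obtain ⟨hf, hT, hcop⟩ := divisor_factorisation hf0 hft
  obtain ⟨n, hn⟩ := heven
  have hn2 : f / Nat.gcd f (2 * t / f) = 2 * n := by rw [hn, two_mul]
  have hn0 : 0 < n := by
    rcases Nat.eq_zero_or_pos n with rfl | h
    · exfalso; apply hf0; rw [hf, hn2, mul_zero, mul_zero]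
    · exact h
  rw [hn2] at hf hcop
  rw [hn2, Nat.mul_div_cancel_left n two_pos]
  exact natCard_admissible_mul_totient_of_even hf0 hn0 hf hT hcop hc₀ hd₀

end Admissible

/-! ### §4 The number of `Õ(L)`-orbits of polarisation vectors of divisor `f` in `L = B₀ ⊕ ⟨−2t⟩` for a general `w` -/

section Lattice

variable {M : Type u} [AddCommGroup M] [Module.Finite ℤ M] [Module.Free ℤ M] {B₀ : BilinForm ℤ M} (t : ℕ)

/-- From one primitive `h ∈ B₀ ⊕ ⟨−2t⟩` with `h² = 2d`, `(h, L) = fℤ` (no hypothesis on `w`): `f ≠ 0`, `f ∣ 2t`, and the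
`l_t`-coordinate `c₀ = h.2` is admissible (`(f, c₀) = 1`, `f² ∣ d + c₀²t`) — "A primitive vector `h_d` with `(h_d, L_{2t}) = fℤ`
can be written `h_d = fv + cl_t` […] The coefficient `c` is coprime to `f` because `h_d` is primitive." (`B₀` even unimodular,
`t ≥ 1`.) [cite: GritsenkoHulekSankaran2010Symplectic, §4 proof of Prop. 4.6, first paragraph] -/
theorem divisor_data (hu : B₀.IsUnimodular) (he : B₀.IsEven) (ht : 0 < t) {r r' : M × ℤ} {f d : ℤ}
    (hr : B₀.prod ((-(2 * t : ℤ)) • LinearMap.mul ℤ ℤ) r r = 2 * d) (hr0 : r ≠ 0)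
    (hrsat : ∀ (k : ℤ) (w : M × ℤ), k ≠ 0 → k • w ∈ ℤ ∙ r → w ∈ ℤ ∙ r)
    (hfr : ∀ z, f ∣ B₀.prod ((-(2 * t : ℤ)) • LinearMap.mul ℤ ℤ) r z)
    (hr' : B₀.prod ((-(2 * t : ℤ)) • LinearMap.mul ℤ ℤ) r r' = f) :
    f ≠ 0 ∧ f ∣ 2 * t ∧ Int.gcd f r.2 = 1 ∧ f ^ 2 ∣ d + t * r.2 ^ 2 := by
  haveI : Module.IsTorsionFree ℤ M := inferInstance
  have hf0 : f ≠ 0 := by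
    rintro rfl
    exact hr0 ((nondegenerate_prod_neg_twoMul_smul_mul B₀ t hu ht).1 r fun z ↦ zero_dvd_iff.1 (hfr z))
  have hc : Int.gcd f r.2 = 1 := gcd_snd_eq_one_of_primitive_of_forall_dvd t hu hr0 hrsat hfr
  have hd : f ^ 2 ∣ d + t * r.2 ^ 2 := sq_dvd_add_mul_snd_sq_of_forall_dvd t hu he hr hfr
  have hft : f ∣ 2 * t :=
    (Int.isCoprime_iff_gcd_eq_one.2 hc).dvd_of_dvd_mul_right (dvd_two_mul_mul_snd_of_forall_dvd t hfr)
  exact ⟨hf0, hft, hc, hd⟩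

/-- **For types that occur, `w = ((2t/f, 2d/f), f) = (f, 2t/f)`**: if a primitive `h ∈ L = B₀ ⊕ ⟨−2t⟩` with `h² = 2d` and
`(h, L) = fℤ` exists, Prop. 4.6's `w` is `(f, 2t/f)` (`B₀` even unimodular, `t ≥ 1`).
[cite: GritsenkoHulekSankaran2010Symplectic, §4 Prop. 4.6 ("`g = (2t/f, 2d/f)`, `w = (g, f)`") and proof (display (c-eq))] -/
theorem w_eq_gcd_of_divisor (hu : B₀.IsUnimodular) (he : B₀.IsEven) (ht : 0 < t) {r r' : M × ℤ} {f d : ℤ}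
    (hr : B₀.prod ((-(2 * t : ℤ)) • LinearMap.mul ℤ ℤ) r r = 2 * d) (hr0 : r ≠ 0)
    (hrsat : ∀ (k : ℤ) (w : M × ℤ), k ≠ 0 → k • w ∈ ℤ ∙ r → w ∈ ℤ ∙ r)
    (hfr : ∀ z, f ∣ B₀.prod ((-(2 * t : ℤ)) • LinearMap.mul ℤ ℤ) r z)
    (hr' : B₀.prod ((-(2 * t : ℤ)) • LinearMap.mul ℤ ℤ) r r' = f) :
    Int.gcd (Int.gcd (2 * t / f) (2 * d / f) : ℤ) f = Int.gcd f (2 * t / f) := by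
  obtain ⟨hf0, hft, -, hd⟩ := divisor_data t hu he ht hr hr0 hrsat hfr hr'
  have hfd : f ∣ 2 * d := by rw [← hr]; exact hfr r
  exact gcd_gcd_eq_gcd_of_sq_dvd hf0 (Int.mul_ediv_cancel' hft).symm (Int.mul_ediv_cancel' hfd).symm hd

/-- **Prop. 4.6 (i)–(iii) for a general `w`, `f₁` odd: the number `N` of `Õ(L)`-orbits of primitive `h ∈ L = B₀ ⊕ ⟨−2t⟩`
with `h² = 2d`, `(h, L) = fℤ` satisfies `N · φ(f₁) = φ(f) · 2^{ρ(f₁)}`** "if at least one `h_d` exists" — i.e.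
`N = w₊(f₁)φ(w₋(f₁)) · 2^{ρ(f₁)}` (printed form: `natCard_quot_stable_isometryEquiv_two_mul_of_divisor_eq_wPlus_mul_of_odd`);
here `w = (f, 2t/f)` (`= ((2t/f, 2d/f), f)`, `w_eq_gcd_of_divisor`), `f = wf₁`, `2t/f = wT₁`, `(f₁, T₁) = 1`. `B₀` even
unimodular with two orthogonal hyperbolic pairs, `t ≥ 1`. [cite: GritsenkoHulekSankaran2010Symplectic, §4 Prop. 4.6 (i)–(iii)] -/
theorem natCard_quot_stable_isometryEquiv_two_mul_of_divisor_mul_totient_of_odd (hu : B₀.IsUnimodular) (he : B₀.IsEven)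
    (ht : 0 < t) {x y x₁ y₁ : M} (h : TwoHyperbolicPairs B₀ x y x₁ y₁) (d : ℤ) {f w f₁ T₁ : ℕ} (hf : f = w * f₁)
    (hT : 2 * t = f * (w * T₁)) (hcop : Nat.Coprime f₁ T₁) (hodd : Odd f₁)
    (hex : ∃ r r' : M × ℤ, B₀.prod ((-(2 * t : ℤ)) • LinearMap.mul ℤ ℤ) r r = 2 * d ∧ r ≠ 0 ∧
      (∀ (k : ℤ) (w : M × ℤ), k ≠ 0 → k • w ∈ ℤ ∙ r → w ∈ ℤ ∙ r) ∧
      (∀ z, (f : ℤ) ∣ B₀.prod ((-(2 * t : ℤ)) • LinearMap.mul ℤ ℤ) r z) ∧ B₀.prod ((-(2 * t : ℤ)) • LinearMap.mul ℤ ℤ) r r' = f) :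
    Nat.card (Quot fun r s : {r : M × ℤ // B₀.prod ((-(2 * t : ℤ)) • LinearMap.mul ℤ ℤ) r r = 2 * d ∧ r ≠ 0 ∧
        (∀ (k : ℤ) (w : M × ℤ), k ≠ 0 → k • w ∈ ℤ ∙ r → w ∈ ℤ ∙ r) ∧
        (∀ z, (f : ℤ) ∣ B₀.prod ((-(2 * t : ℤ)) • LinearMap.mul ℤ ℤ) r z) ∧
        ∃ r', B₀.prod ((-(2 * t : ℤ)) • LinearMap.mul ℤ ℤ) r r' = f} ↦
      ∃ g : (B₀.prod ((-(2 * t : ℤ)) • LinearMap.mul ℤ ℤ)).IsometryEquiv (B₀.prod ((-(2 * t : ℤ)) • LinearMap.mul ℤ ℤ)),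
        g.discriminantGroupCongr = LinearEquiv.refl ℤ _ ∧ g r.1 = s.1) * Nat.totient f₁ = Nat.totient f * 2 ^ f₁.primeFactors.card := by
  obtain ⟨r, r', hr, hr0, hrsat, hfr, hr'⟩ := hex
  obtain ⟨hf0, hft, hc, hd⟩ := divisor_data t hu he ht hr hr0 hrsat hfr hr'
  have hf0' : f ≠ 0 := by exact_mod_cast hf0
  rw [natCard_quot_stable_isometryEquiv_two_mul_of_divisor t hu he ht h d (Nat.pos_of_ne_zero hf0') hft]
  exact natCard_admissible_mul_totient_of_odd hf0' hf hT hcop hodd hc hd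

/-- **Prop. 4.6 (ii) for a general `w`, `f₁ = 2n` even: the number `N` of `Õ(L)`-orbits of primitive `h ∈ L = B₀ ⊕ ⟨−2t⟩`
with `h² = 2d`, `(h, L) = fℤ` satisfies `N · φ(2n) = φ(f) · 2^{ρ(n)}`** if at least one exists — i.e.
`N = w₊(f₁)φ(w₋(f₁)) · 2^{ρ(f₁/2)}`; `w = (f, 2t/f)`, `f = w·2n`, `2t/f = wT₁`, `(2n, T₁) = 1`. `B₀` even unimodular with two
orthogonal hyperbolic pairs, `t ≥ 1`. [cite: GritsenkoHulekSankaran2010Symplectic, §4 Prop. 4.6 (ii)] -/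
theorem natCard_quot_stable_isometryEquiv_two_mul_of_divisor_mul_totient_of_even (hu : B₀.IsUnimodular) (he : B₀.IsEven)
    (ht : 0 < t) {x y x₁ y₁ : M} (h : TwoHyperbolicPairs B₀ x y x₁ y₁) (d : ℤ) {f w n T₁ : ℕ} (hn : 0 < n)
    (hf : f = w * (2 * n)) (hT : 2 * t = f * (w * T₁)) (hcop : Nat.Coprime (2 * n) T₁)
    (hex : ∃ r r' : M × ℤ, B₀.prod ((-(2 * t : ℤ)) • LinearMap.mul ℤ ℤ) r r = 2 * d ∧ r ≠ 0 ∧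
      (∀ (k : ℤ) (w : M × ℤ), k ≠ 0 → k • w ∈ ℤ ∙ r → w ∈ ℤ ∙ r) ∧
      (∀ z, (f : ℤ) ∣ B₀.prod ((-(2 * t : ℤ)) • LinearMap.mul ℤ ℤ) r z) ∧ B₀.prod ((-(2 * t : ℤ)) • LinearMap.mul ℤ ℤ) r r' = f) :
    Nat.card (Quot fun r s : {r : M × ℤ // B₀.prod ((-(2 * t : ℤ)) • LinearMap.mul ℤ ℤ) r r = 2 * d ∧ r ≠ 0 ∧
        (∀ (k : ℤ) (w : M × ℤ), k ≠ 0 → k • w ∈ ℤ ∙ r → w ∈ ℤ ∙ r) ∧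
        (∀ z, (f : ℤ) ∣ B₀.prod ((-(2 * t : ℤ)) • LinearMap.mul ℤ ℤ) r z) ∧
        ∃ r', B₀.prod ((-(2 * t : ℤ)) • LinearMap.mul ℤ ℤ) r r' = f} ↦
      ∃ g : (B₀.prod ((-(2 * t : ℤ)) • LinearMap.mul ℤ ℤ)).IsometryEquiv (B₀.prod ((-(2 * t : ℤ)) • LinearMap.mul ℤ ℤ)),
        g.discriminantGroupCongr = LinearEquiv.refl ℤ _ ∧ g r.1 = s.1) * Nat.totient (2 * n) = Nat.totient f * 2 ^ n.primeFactors.card := by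
  obtain ⟨r, r', hr, hr0, hrsat, hfr, hr'⟩ := hex
  obtain ⟨hf0, hft, hc, hd⟩ := divisor_data t hu he ht hr hr0 hrsat hfr hr'
  have hf0' : f ≠ 0 := by exact_mod_cast hf0
  rw [natCard_quot_stable_isometryEquiv_two_mul_of_divisor t hu he ht h d (Nat.pos_of_ne_zero hf0') hft]
  exact natCard_admissible_mul_totient_of_even hf0' hn hf hT hcop hc hd

/-- **Prop. 4.6 (i)–(iii) in the printed form, `f₁` odd: the number of `Õ(L)`-orbits of primitive `h ∈ L = B₀ ⊕ ⟨−2t⟩` with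
`h² = 2d`, `div(h) = f` "(if at least one `h_d` exists) is equal to `w₊(f₁)φ(w₋(f₁)) · 2^{ρ(f₁)}`"**, `w₊(f₁) = ∏_{p ∣ (w,f₁)} p^{v_p(w)}`,
`w₋(f₁) = w/w₊(f₁)`; `w = (f, 2t/f)`, `f = wf₁`, `2t/f = wT₁`, `(f₁, T₁) = 1`. [cite: GritsenkoHulekSankaran2010Symplectic, §4 Prop. 4.6 (i)–(iii)] -/
theorem natCard_quot_stable_isometryEquiv_two_mul_of_divisor_eq_wPlus_mul_of_odd (hu : B₀.IsUnimodular) (he : B₀.IsEven)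
    (ht : 0 < t) {x y x₁ y₁ : M} (h : TwoHyperbolicPairs B₀ x y x₁ y₁) (d : ℤ) {f w f₁ T₁ : ℕ} (hf : f = w * f₁)
    (hT : 2 * t = f * (w * T₁)) (hcop : Nat.Coprime f₁ T₁) (hodd : Odd f₁)
    (hex : ∃ r r' : M × ℤ, B₀.prod ((-(2 * t : ℤ)) • LinearMap.mul ℤ ℤ) r r = 2 * d ∧ r ≠ 0 ∧
      (∀ (k : ℤ) (w : M × ℤ), k ≠ 0 → k • w ∈ ℤ ∙ r → w ∈ ℤ ∙ r) ∧
      (∀ z, (f : ℤ) ∣ B₀.prod ((-(2 * t : ℤ)) • LinearMap.mul ℤ ℤ) r z) ∧ B₀.prod ((-(2 * t : ℤ)) • LinearMap.mul ℤ ℤ) r r' = f) :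
    Nat.card (Quot fun r s : {r : M × ℤ // B₀.prod ((-(2 * t : ℤ)) • LinearMap.mul ℤ ℤ) r r = 2 * d ∧ r ≠ 0 ∧
        (∀ (k : ℤ) (w : M × ℤ), k ≠ 0 → k • w ∈ ℤ ∙ r → w ∈ ℤ ∙ r) ∧
        (∀ z, (f : ℤ) ∣ B₀.prod ((-(2 * t : ℤ)) • LinearMap.mul ℤ ℤ) r z) ∧
        ∃ r', B₀.prod ((-(2 * t : ℤ)) • LinearMap.mul ℤ ℤ) r r' = f} ↦
      ∃ g : (B₀.prod ((-(2 * t : ℤ)) • LinearMap.mul ℤ ℤ)).IsometryEquiv (B₀.prod ((-(2 * t : ℤ)) • LinearMap.mul ℤ ℤ)),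
        g.discriminantGroupCongr = LinearEquiv.refl ℤ _ ∧ g r.1 = s.1) =
      (∏ p ∈ w.primeFactors with p ∣ f₁, p ^ w.factorization p) *
        Nat.totient (∏ p ∈ w.primeFactors with ¬p ∣ f₁, p ^ w.factorization p) * 2 ^ f₁.primeFactors.card := by
  obtain ⟨r, r', hr, hr0, hrsat, hfr, hr'⟩ := hex
  obtain ⟨hf0, hft, hc, hd⟩ := divisor_data t hu he ht hr hr0 hrsat hfr hr'
  have hf0' : f ≠ 0 := by exact_mod_cast hf0
  rw [natCard_quot_stable_isometryEquiv_two_mul_of_divisor t hu he ht h d (Nat.pos_of_ne_zero hf0') hft]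
  exact natCard_admissible_eq_wPlus_mul_totient_wMinus_mul_two_pow_of_odd hf0' hf hT hcop hodd hc hd

/-- **Prop. 4.6 (ii) in the printed form, `f₁ = 2n` even: the number of `Õ(L)`-orbits "is equal to
`w₊(f₁)φ(w₋(f₁)) · 2^{ρ(f₁/2)}` if `f₁ ≡ 0 mod 2`"** (`w = (f, 2t/f)`, `f = w·2n`, `2t/f = wT₁`, `(2n, T₁) = 1`).
[cite: GritsenkoHulekSankaran2010Symplectic, §4 Prop. 4.6 (ii)] -/
theorem natCard_quot_stable_isometryEquiv_two_mul_of_divisor_eq_wPlus_mul_of_even (hu : B₀.IsUnimodular) (he : B₀.IsEven)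
    (ht : 0 < t) {x y x₁ y₁ : M} (h : TwoHyperbolicPairs B₀ x y x₁ y₁) (d : ℤ) {f w n T₁ : ℕ} (hn : 0 < n)
    (hf : f = w * (2 * n)) (hT : 2 * t = f * (w * T₁)) (hcop : Nat.Coprime (2 * n) T₁)
    (hex : ∃ r r' : M × ℤ, B₀.prod ((-(2 * t : ℤ)) • LinearMap.mul ℤ ℤ) r r = 2 * d ∧ r ≠ 0 ∧
      (∀ (k : ℤ) (w : M × ℤ), k ≠ 0 → k • w ∈ ℤ ∙ r → w ∈ ℤ ∙ r) ∧
      (∀ z, (f : ℤ) ∣ B₀.prod ((-(2 * t : ℤ)) • LinearMap.mul ℤ ℤ) r z) ∧ B₀.prod ((-(2 * t : ℤ)) • LinearMap.mul ℤ ℤ) r r' = f) :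
    Nat.card (Quot fun r s : {r : M × ℤ // B₀.prod ((-(2 * t : ℤ)) • LinearMap.mul ℤ ℤ) r r = 2 * d ∧ r ≠ 0 ∧
        (∀ (k : ℤ) (w : M × ℤ), k ≠ 0 → k • w ∈ ℤ ∙ r → w ∈ ℤ ∙ r) ∧
        (∀ z, (f : ℤ) ∣ B₀.prod ((-(2 * t : ℤ)) • LinearMap.mul ℤ ℤ) r z) ∧
        ∃ r', B₀.prod ((-(2 * t : ℤ)) • LinearMap.mul ℤ ℤ) r r' = f} ↦
      ∃ g : (B₀.prod ((-(2 * t : ℤ)) • LinearMap.mul ℤ ℤ)).IsometryEquiv (B₀.prod ((-(2 * t : ℤ)) • LinearMap.mul ℤ ℤ)),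
        g.discriminantGroupCongr = LinearEquiv.refl ℤ _ ∧ g r.1 = s.1) =
      (∏ p ∈ w.primeFactors with p ∣ 2 * n, p ^ w.factorization p) *
        Nat.totient (∏ p ∈ w.primeFactors with ¬p ∣ 2 * n, p ^ w.factorization p) * 2 ^ n.primeFactors.card := by
  obtain ⟨r, r', hr, hr0, hrsat, hfr, hr'⟩ := hex
  obtain ⟨hf0, hft, hc, hd⟩ := divisor_data t hu he ht hr hr0 hrsat hfr hr'
  have hf0' : f ≠ 0 := by exact_mod_cast hf0
  rw [natCard_quot_stable_isometryEquiv_two_mul_of_divisor t hu he ht h d (Nat.pos_of_ne_zero hf0') hft]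
  exact natCard_admissible_eq_wPlus_mul_totient_wMinus_mul_two_pow_of_even hf0' hn hf hT hcop hc hd

/-- **The orbit number in closed form, `f/(f, 2t/f)` odd**: with `f₁ = f/(f, 2t/f)`, the number `N` of `Õ(L)`-orbits of primitive
`h ∈ L = B₀ ⊕ ⟨−2t⟩` with `h² = 2d`, `(h, L) = fℤ` (one exists) satisfies `N · φ(f₁) = φ(f) · 2^{ρ(f₁)}` — for `(f, 2t/f) = 1`
this is the `2^{ρ(f)}` of row g44-#3 (`natCard_quot_stable_isometryEquiv_two_mul_of_divisor_of_odd`).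
[cite: GritsenkoHulekSankaran2010Symplectic, §4 Prop. 4.6 (i)–(iii)] -/
theorem natCard_quot_stable_isometryEquiv_two_mul_of_divisor_mul_totient_div_gcd_of_odd (hu : B₀.IsUnimodular)
    (he : B₀.IsEven) (ht : 0 < t) {x y x₁ y₁ : M} (h : TwoHyperbolicPairs B₀ x y x₁ y₁) (d : ℤ) {f : ℕ}
    (hodd : Odd (f / Nat.gcd f (2 * t / f)))
    (hex : ∃ r r' : M × ℤ, B₀.prod ((-(2 * t : ℤ)) • LinearMap.mul ℤ ℤ) r r = 2 * d ∧ r ≠ 0 ∧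
      (∀ (k : ℤ) (w : M × ℤ), k ≠ 0 → k • w ∈ ℤ ∙ r → w ∈ ℤ ∙ r) ∧
      (∀ z, (f : ℤ) ∣ B₀.prod ((-(2 * t : ℤ)) • LinearMap.mul ℤ ℤ) r z) ∧ B₀.prod ((-(2 * t : ℤ)) • LinearMap.mul ℤ ℤ) r r' = f) :
    Nat.card (Quot fun r s : {r : M × ℤ // B₀.prod ((-(2 * t : ℤ)) • LinearMap.mul ℤ ℤ) r r = 2 * d ∧ r ≠ 0 ∧
        (∀ (k : ℤ) (w : M × ℤ), k ≠ 0 → k • w ∈ ℤ ∙ r → w ∈ ℤ ∙ r) ∧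
        (∀ z, (f : ℤ) ∣ B₀.prod ((-(2 * t : ℤ)) • LinearMap.mul ℤ ℤ) r z) ∧
        ∃ r', B₀.prod ((-(2 * t : ℤ)) • LinearMap.mul ℤ ℤ) r r' = f} ↦
      ∃ g : (B₀.prod ((-(2 * t : ℤ)) • LinearMap.mul ℤ ℤ)).IsometryEquiv (B₀.prod ((-(2 * t : ℤ)) • LinearMap.mul ℤ ℤ)),
        g.discriminantGroupCongr = LinearEquiv.refl ℤ _ ∧ g r.1 = s.1) * Nat.totient (f / Nat.gcd f (2 * t / f)) =
      Nat.totient f * 2 ^ (f / Nat.gcd f (2 * t / f)).primeFactors.card := by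
  obtain ⟨r, r', hr, hr0, hrsat, hfr, hr'⟩ := hex
  obtain ⟨hf0, hft, hc, hd⟩ := divisor_data t hu he ht hr hr0 hrsat hfr hr'
  have hf0' : f ≠ 0 := by exact_mod_cast hf0
  rw [natCard_quot_stable_isometryEquiv_two_mul_of_divisor t hu he ht h d (Nat.pos_of_ne_zero hf0') hft]
  exact natCard_admissible_mul_totient_div_gcd_of_odd hf0' hft hodd hc hd

/-- **The orbit number in closed form, `f/(f, 2t/f)` even**: with `f₁ = f/(f, 2t/f)`, the number `N` of `Õ(L)`-orbits satisfies
`N · φ(f₁) = φ(f) · 2^{ρ(f₁/2)}` — for `(f, 2t/f) = 1` the `2^{ρ(f/2)}` of row g44-#3.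
[cite: GritsenkoHulekSankaran2010Symplectic, §4 Prop. 4.6 (ii)] -/
theorem natCard_quot_stable_isometryEquiv_two_mul_of_divisor_mul_totient_div_gcd_of_even (hu : B₀.IsUnimodular)
    (he : B₀.IsEven) (ht : 0 < t) {x y x₁ y₁ : M} (h : TwoHyperbolicPairs B₀ x y x₁ y₁) (d : ℤ) {f : ℕ}
    (heven : Even (f / Nat.gcd f (2 * t / f)))
    (hex : ∃ r r' : M × ℤ, B₀.prod ((-(2 * t : ℤ)) • LinearMap.mul ℤ ℤ) r r = 2 * d ∧ r ≠ 0 ∧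
      (∀ (k : ℤ) (w : M × ℤ), k ≠ 0 → k • w ∈ ℤ ∙ r → w ∈ ℤ ∙ r) ∧
      (∀ z, (f : ℤ) ∣ B₀.prod ((-(2 * t : ℤ)) • LinearMap.mul ℤ ℤ) r z) ∧ B₀.prod ((-(2 * t : ℤ)) • LinearMap.mul ℤ ℤ) r r' = f) :
    Nat.card (Quot fun r s : {r : M × ℤ // B₀.prod ((-(2 * t : ℤ)) • LinearMap.mul ℤ ℤ) r r = 2 * d ∧ r ≠ 0 ∧
        (∀ (k : ℤ) (w : M × ℤ), k ≠ 0 → k • w ∈ ℤ ∙ r → w ∈ ℤ ∙ r) ∧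
        (∀ z, (f : ℤ) ∣ B₀.prod ((-(2 * t : ℤ)) • LinearMap.mul ℤ ℤ) r z) ∧
        ∃ r', B₀.prod ((-(2 * t : ℤ)) • LinearMap.mul ℤ ℤ) r r' = f} ↦
      ∃ g : (B₀.prod ((-(2 * t : ℤ)) • LinearMap.mul ℤ ℤ)).IsometryEquiv (B₀.prod ((-(2 * t : ℤ)) • LinearMap.mul ℤ ℤ)),
        g.discriminantGroupCongr = LinearEquiv.refl ℤ _ ∧ g r.1 = s.1) * Nat.totient (f / Nat.gcd f (2 * t / f)) =
      Nat.totient f * 2 ^ (f / Nat.gcd f (2 * t / f) / 2).primeFactors.card := by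
  obtain ⟨r, r', hr, hr0, hrsat, hfr, hr'⟩ := hex
  obtain ⟨hf0, hft, hc, hd⟩ := divisor_data t hu he ht hr hr0 hrsat hfr hr'
  have hf0' : f ≠ 0 := by exact_mod_cast hf0
  rw [natCard_quot_stable_isometryEquiv_two_mul_of_divisor t hu he ht h d (Nat.pos_of_ne_zero hf0') hft]
  exact natCard_admissible_mul_totient_div_gcd_of_even hf0' hft heven hc hd

end Lattice

/-! ### §5 The models `(E₈(−1)^{⊕m} ⊕ U^{⊕(k+2)}) ⊕ ℤ(−2t)` (`L_{2t}`: `m = 2`, `k = 1`; `Λ(Kumⁿ)`: `m = 0`, `k = 1`, `t = n + 1`) -/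

section Model

variable (m k t : ℕ)

/-- **Prop. 4.6 (i)–(iii) for a general `w` in the models, `f₁` odd**: the number `N` of `Õ`-orbits of primitive `h` with
`h² = 2d`, `(h, L) = fℤ` in `(E₈(−1)^{⊕m} ⊕ U^{⊕(k+2)}) ⊕ ℤ(−2t)` (one exists) satisfies `N · φ(f₁) = φ(f) · 2^{ρ(f₁)}`
(`w = (f, 2t/f)`, `f = wf₁`, `2t/f = wT₁`, `(f₁, T₁) = 1`). [cite: GritsenkoHulekSankaran2010Symplectic, §4 Prop. 4.6 (i)–(iii)] -/
theorem natCard_quot_stable_isometryEquiv_model_two_mul_of_divisor_mul_totient_of_odd (ht : 0 < t) (d : ℤ)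
    {f w f₁ T₁ : ℕ} (hf : f = w * f₁) (hT : 2 * t = f * (w * T₁)) (hcop : Nat.Coprime f₁ T₁) (hodd : Odd f₁)
    (hex : ∃ r r' : ((Fin m → Fin 8 → ℤ) × ((Fin (k + 2) → ℤ) × (Fin (k + 2) → ℤ))) × ℤ,
      (((LinearMap.BilinForm.pi fun _ : Fin m ↦ -e8Form).prod (hyperbolicSum (k + 2))).prod
        ((-(2 * t : ℤ)) • LinearMap.mul ℤ ℤ)) r r = 2 * d ∧ r ≠ 0 ∧
      (∀ (a : ℤ) (w : ((Fin m → Fin 8 → ℤ) × ((Fin (k + 2) → ℤ) × (Fin (k + 2) → ℤ))) × ℤ), a ≠ 0 →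
        a • w ∈ ℤ ∙ r → w ∈ ℤ ∙ r) ∧
      (∀ z, (f : ℤ) ∣ (((LinearMap.BilinForm.pi fun _ : Fin m ↦ -e8Form).prod (hyperbolicSum (k + 2))).prod
        ((-(2 * t : ℤ)) • LinearMap.mul ℤ ℤ)) r z) ∧
      (((LinearMap.BilinForm.pi fun _ : Fin m ↦ -e8Form).prod (hyperbolicSum (k + 2))).prod
        ((-(2 * t : ℤ)) • LinearMap.mul ℤ ℤ)) r r' = f) :
    Nat.card (Quot fun r s : {r : ((Fin m → Fin 8 → ℤ) × ((Fin (k + 2) → ℤ) × (Fin (k + 2) → ℤ))) × ℤ //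
        (((LinearMap.BilinForm.pi fun _ : Fin m ↦ -e8Form).prod (hyperbolicSum (k + 2))).prod
        ((-(2 * t : ℤ)) • LinearMap.mul ℤ ℤ)) r r = 2 * d ∧ r ≠ 0 ∧
        (∀ (a : ℤ) (w : ((Fin m → Fin 8 → ℤ) × ((Fin (k + 2) → ℤ) × (Fin (k + 2) → ℤ))) × ℤ), a ≠ 0 →
          a • w ∈ ℤ ∙ r → w ∈ ℤ ∙ r) ∧
        (∀ z, (f : ℤ) ∣ (((LinearMap.BilinForm.pi fun _ : Fin m ↦ -e8Form).prod (hyperbolicSum (k + 2))).prod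
        ((-(2 * t : ℤ)) • LinearMap.mul ℤ ℤ)) r z) ∧
        ∃ r', (((LinearMap.BilinForm.pi fun _ : Fin m ↦ -e8Form).prod (hyperbolicSum (k + 2))).prod
        ((-(2 * t : ℤ)) • LinearMap.mul ℤ ℤ)) r r' = f} ↦
      ∃ g : ((((LinearMap.BilinForm.pi fun _ : Fin m ↦ -e8Form).prod (hyperbolicSum (k + 2))).prod
        ((-(2 * t : ℤ)) • LinearMap.mul ℤ ℤ))).IsometryEquiv
          ((((LinearMap.BilinForm.pi fun _ : Fin m ↦ -e8Form).prod (hyperbolicSum (k + 2))).prod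
        ((-(2 * t : ℤ)) • LinearMap.mul ℤ ℤ))),
        g.discriminantGroupCongr = LinearEquiv.refl ℤ _ ∧ g r.1 = s.1) * Nat.totient f₁ = Nat.totient f * 2 ^ f₁.primeFactors.card := by
  obtain ⟨-, heB, huB⟩ := isSymm_isEven_isUnimodular_pi_neg_e8Form_prod_hyperbolicSum' m (k + 2)
  exact natCard_quot_stable_isometryEquiv_two_mul_of_divisor_mul_totient_of_odd t huB heB ht
    (twoHyperbolicPairs_pi_neg_e8Form_prod_hyperbolicSum_add_two m k) d hf hT hcop hodd hex

/-- **Prop. 4.6 (ii) for a general `w` in the models, `f₁ = 2n` even**: `N · φ(2n) = φ(f) · 2^{ρ(n)}` for the number `N` of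
`Õ`-orbits of primitive `h` with `h² = 2d`, `(h, L) = fℤ` in `(E₈(−1)^{⊕m} ⊕ U^{⊕(k+2)}) ⊕ ℤ(−2t)` (one exists; `f = w·2n`,
`2t/f = wT₁`, `(2n, T₁) = 1`). [cite: GritsenkoHulekSankaran2010Symplectic, §4 Prop. 4.6 (ii)] -/
theorem natCard_quot_stable_isometryEquiv_model_two_mul_of_divisor_mul_totient_of_even (ht : 0 < t) (d : ℤ)
    {f w n T₁ : ℕ} (hn : 0 < n) (hf : f = w * (2 * n)) (hT : 2 * t = f * (w * T₁)) (hcop : Nat.Coprime (2 * n) T₁)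
    (hex : ∃ r r' : ((Fin m → Fin 8 → ℤ) × ((Fin (k + 2) → ℤ) × (Fin (k + 2) → ℤ))) × ℤ,
      (((LinearMap.BilinForm.pi fun _ : Fin m ↦ -e8Form).prod (hyperbolicSum (k + 2))).prod
        ((-(2 * t : ℤ)) • LinearMap.mul ℤ ℤ)) r r = 2 * d ∧ r ≠ 0 ∧
      (∀ (a : ℤ) (w : ((Fin m → Fin 8 → ℤ) × ((Fin (k + 2) → ℤ) × (Fin (k + 2) → ℤ))) × ℤ), a ≠ 0 →
        a • w ∈ ℤ ∙ r → w ∈ ℤ ∙ r) ∧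
      (∀ z, (f : ℤ) ∣ (((LinearMap.BilinForm.pi fun _ : Fin m ↦ -e8Form).prod (hyperbolicSum (k + 2))).prod
        ((-(2 * t : ℤ)) • LinearMap.mul ℤ ℤ)) r z) ∧
      (((LinearMap.BilinForm.pi fun _ : Fin m ↦ -e8Form).prod (hyperbolicSum (k + 2))).prod
        ((-(2 * t : ℤ)) • LinearMap.mul ℤ ℤ)) r r' = f) :
    Nat.card (Quot fun r s : {r : ((Fin m → Fin 8 → ℤ) × ((Fin (k + 2) → ℤ) × (Fin (k + 2) → ℤ))) × ℤ //
        (((LinearMap.BilinForm.pi fun _ : Fin m ↦ -e8Form).prod (hyperbolicSum (k + 2))).prod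
        ((-(2 * t : ℤ)) • LinearMap.mul ℤ ℤ)) r r = 2 * d ∧ r ≠ 0 ∧
        (∀ (a : ℤ) (w : ((Fin m → Fin 8 → ℤ) × ((Fin (k + 2) → ℤ) × (Fin (k + 2) → ℤ))) × ℤ), a ≠ 0 →
          a • w ∈ ℤ ∙ r → w ∈ ℤ ∙ r) ∧
        (∀ z, (f : ℤ) ∣ (((LinearMap.BilinForm.pi fun _ : Fin m ↦ -e8Form).prod (hyperbolicSum (k + 2))).prod
        ((-(2 * t : ℤ)) • LinearMap.mul ℤ ℤ)) r z) ∧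
        ∃ r', (((LinearMap.BilinForm.pi fun _ : Fin m ↦ -e8Form).prod (hyperbolicSum (k + 2))).prod
        ((-(2 * t : ℤ)) • LinearMap.mul ℤ ℤ)) r r' = f} ↦
      ∃ g : ((((LinearMap.BilinForm.pi fun _ : Fin m ↦ -e8Form).prod (hyperbolicSum (k + 2))).prod
        ((-(2 * t : ℤ)) • LinearMap.mul ℤ ℤ))).IsometryEquiv
          ((((LinearMap.BilinForm.pi fun _ : Fin m ↦ -e8Form).prod (hyperbolicSum (k + 2))).prod
        ((-(2 * t : ℤ)) • LinearMap.mul ℤ ℤ))),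
        g.discriminantGroupCongr = LinearEquiv.refl ℤ _ ∧ g r.1 = s.1) * Nat.totient (2 * n) = Nat.totient f * 2 ^ n.primeFactors.card := by
  obtain ⟨-, heB, huB⟩ := isSymm_isEven_isUnimodular_pi_neg_e8Form_prod_hyperbolicSum' m (k + 2)
  exact natCard_quot_stable_isometryEquiv_two_mul_of_divisor_mul_totient_of_even t huB heB ht
    (twoHyperbolicPairs_pi_neg_e8Form_prod_hyperbolicSum_add_two m k) d hn hf hT hcop hex

/-- **The orbit number in closed form in the models, `f/(f, 2t/f)` odd**: `N · φ(f₁) = φ(f) · 2^{ρ(f₁)}` with `f₁ = f/(f, 2t/f)`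
for the number `N` of `Õ`-orbits of primitive `h` with `h² = 2d`, `(h, L) = fℤ` in `(E₈(−1)^{⊕m} ⊕ U^{⊕(k+2)}) ⊕ ℤ(−2t)` (one
exists). [cite: GritsenkoHulekSankaran2010Symplectic, §4 Prop. 4.6 (i)–(iii)] -/
theorem natCard_quot_stable_isometryEquiv_model_two_mul_of_divisor_mul_totient_div_gcd_of_odd (ht : 0 < t) (d : ℤ)
    {f : ℕ} (hodd : Odd (f / Nat.gcd f (2 * t / f)))
    (hex : ∃ r r' : ((Fin m → Fin 8 → ℤ) × ((Fin (k + 2) → ℤ) × (Fin (k + 2) → ℤ))) × ℤ,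
      (((LinearMap.BilinForm.pi fun _ : Fin m ↦ -e8Form).prod (hyperbolicSum (k + 2))).prod
        ((-(2 * t : ℤ)) • LinearMap.mul ℤ ℤ)) r r = 2 * d ∧ r ≠ 0 ∧
      (∀ (a : ℤ) (w : ((Fin m → Fin 8 → ℤ) × ((Fin (k + 2) → ℤ) × (Fin (k + 2) → ℤ))) × ℤ), a ≠ 0 →
        a • w ∈ ℤ ∙ r → w ∈ ℤ ∙ r) ∧
      (∀ z, (f : ℤ) ∣ (((LinearMap.BilinForm.pi fun _ : Fin m ↦ -e8Form).prod (hyperbolicSum (k + 2))).prod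
        ((-(2 * t : ℤ)) • LinearMap.mul ℤ ℤ)) r z) ∧
      (((LinearMap.BilinForm.pi fun _ : Fin m ↦ -e8Form).prod (hyperbolicSum (k + 2))).prod
        ((-(2 * t : ℤ)) • LinearMap.mul ℤ ℤ)) r r' = f) :
    Nat.card (Quot fun r s : {r : ((Fin m → Fin 8 → ℤ) × ((Fin (k + 2) → ℤ) × (Fin (k + 2) → ℤ))) × ℤ //
        (((LinearMap.BilinForm.pi fun _ : Fin m ↦ -e8Form).prod (hyperbolicSum (k + 2))).prod
        ((-(2 * t : ℤ)) • LinearMap.mul ℤ ℤ)) r r = 2 * d ∧ r ≠ 0 ∧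
        (∀ (a : ℤ) (w : ((Fin m → Fin 8 → ℤ) × ((Fin (k + 2) → ℤ) × (Fin (k + 2) → ℤ))) × ℤ), a ≠ 0 →
          a • w ∈ ℤ ∙ r → w ∈ ℤ ∙ r) ∧
        (∀ z, (f : ℤ) ∣ (((LinearMap.BilinForm.pi fun _ : Fin m ↦ -e8Form).prod (hyperbolicSum (k + 2))).prod
        ((-(2 * t : ℤ)) • LinearMap.mul ℤ ℤ)) r z) ∧
        ∃ r', (((LinearMap.BilinForm.pi fun _ : Fin m ↦ -e8Form).prod (hyperbolicSum (k + 2))).prod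
        ((-(2 * t : ℤ)) • LinearMap.mul ℤ ℤ)) r r' = f} ↦
      ∃ g : ((((LinearMap.BilinForm.pi fun _ : Fin m ↦ -e8Form).prod (hyperbolicSum (k + 2))).prod
        ((-(2 * t : ℤ)) • LinearMap.mul ℤ ℤ))).IsometryEquiv
          ((((LinearMap.BilinForm.pi fun _ : Fin m ↦ -e8Form).prod (hyperbolicSum (k + 2))).prod
        ((-(2 * t : ℤ)) • LinearMap.mul ℤ ℤ))),
        g.discriminantGroupCongr = LinearEquiv.refl ℤ _ ∧ g r.1 = s.1) * Nat.totient (f / Nat.gcd f (2 * t / f)) =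
      Nat.totient f * 2 ^ (f / Nat.gcd f (2 * t / f)).primeFactors.card := by
  obtain ⟨-, heB, huB⟩ := isSymm_isEven_isUnimodular_pi_neg_e8Form_prod_hyperbolicSum' m (k + 2)
  exact natCard_quot_stable_isometryEquiv_two_mul_of_divisor_mul_totient_div_gcd_of_odd t huB heB ht
    (twoHyperbolicPairs_pi_neg_e8Form_prod_hyperbolicSum_add_two m k) d hodd hex

/-- **The orbit number in closed form in the models, `f/(f, 2t/f)` even**: `N · φ(f₁) = φ(f) · 2^{ρ(f₁/2)}` with
`f₁ = f/(f, 2t/f)`. [cite: GritsenkoHulekSankaran2010Symplectic, §4 Prop. 4.6 (ii)] -/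
theorem natCard_quot_stable_isometryEquiv_model_two_mul_of_divisor_mul_totient_div_gcd_of_even (ht : 0 < t) (d : ℤ)
    {f : ℕ} (heven : Even (f / Nat.gcd f (2 * t / f)))
    (hex : ∃ r r' : ((Fin m → Fin 8 → ℤ) × ((Fin (k + 2) → ℤ) × (Fin (k + 2) → ℤ))) × ℤ,
      (((LinearMap.BilinForm.pi fun _ : Fin m ↦ -e8Form).prod (hyperbolicSum (k + 2))).prod
        ((-(2 * t : ℤ)) • LinearMap.mul ℤ ℤ)) r r = 2 * d ∧ r ≠ 0 ∧
      (∀ (a : ℤ) (w : ((Fin m → Fin 8 → ℤ) × ((Fin (k + 2) → ℤ) × (Fin (k + 2) → ℤ))) × ℤ), a ≠ 0 →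
        a • w ∈ ℤ ∙ r → w ∈ ℤ ∙ r) ∧
      (∀ z, (f : ℤ) ∣ (((LinearMap.BilinForm.pi fun _ : Fin m ↦ -e8Form).prod (hyperbolicSum (k + 2))).prod
        ((-(2 * t : ℤ)) • LinearMap.mul ℤ ℤ)) r z) ∧
      (((LinearMap.BilinForm.pi fun _ : Fin m ↦ -e8Form).prod (hyperbolicSum (k + 2))).prod
        ((-(2 * t : ℤ)) • LinearMap.mul ℤ ℤ)) r r' = f) :
    Nat.card (Quot fun r s : {r : ((Fin m → Fin 8 → ℤ) × ((Fin (k + 2) → ℤ) × (Fin (k + 2) → ℤ))) × ℤ //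
        (((LinearMap.BilinForm.pi fun _ : Fin m ↦ -e8Form).prod (hyperbolicSum (k + 2))).prod
        ((-(2 * t : ℤ)) • LinearMap.mul ℤ ℤ)) r r = 2 * d ∧ r ≠ 0 ∧
        (∀ (a : ℤ) (w : ((Fin m → Fin 8 → ℤ) × ((Fin (k + 2) → ℤ) × (Fin (k + 2) → ℤ))) × ℤ), a ≠ 0 →
          a • w ∈ ℤ ∙ r → w ∈ ℤ ∙ r) ∧
        (∀ z, (f : ℤ) ∣ (((LinearMap.BilinForm.pi fun _ : Fin m ↦ -e8Form).prod (hyperbolicSum (k + 2))).prod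
        ((-(2 * t : ℤ)) • LinearMap.mul ℤ ℤ)) r z) ∧
        ∃ r', (((LinearMap.BilinForm.pi fun _ : Fin m ↦ -e8Form).prod (hyperbolicSum (k + 2))).prod
        ((-(2 * t : ℤ)) • LinearMap.mul ℤ ℤ)) r r' = f} ↦
      ∃ g : ((((LinearMap.BilinForm.pi fun _ : Fin m ↦ -e8Form).prod (hyperbolicSum (k + 2))).prod
        ((-(2 * t : ℤ)) • LinearMap.mul ℤ ℤ))).IsometryEquiv
          ((((LinearMap.BilinForm.pi fun _ : Fin m ↦ -e8Form).prod (hyperbolicSum (k + 2))).prod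
        ((-(2 * t : ℤ)) • LinearMap.mul ℤ ℤ))),
        g.discriminantGroupCongr = LinearEquiv.refl ℤ _ ∧ g r.1 = s.1) * Nat.totient (f / Nat.gcd f (2 * t / f)) =
      Nat.totient f * 2 ^ (f / Nat.gcd f (2 * t / f) / 2).primeFactors.card := by
  obtain ⟨-, heB, huB⟩ := isSymm_isEven_isUnimodular_pi_neg_e8Form_prod_hyperbolicSum' m (k + 2)
  exact natCard_quot_stable_isometryEquiv_two_mul_of_divisor_mul_totient_div_gcd_of_even t huB heB ht
    (twoHyperbolicPairs_pi_neg_e8Form_prod_hyperbolicSum_add_two m k) d heven hex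

end Model

/-! ### §6 Prop. 4.6 (iv): "The greatest common divisor of the elements of `B` is equal to `g₁(2b/g₁, w)`" -/

section Entries

/-- `Int.gcd a |x| = Int.gcd a x`. [folklore] -/
private theorem int_gcd_natAbs_right (a x : ℤ) : Int.gcd a (x.natAbs : ℤ) = Int.gcd a x := by
  rw [Int.gcd_eq_natAbs_gcd_natAbs, Int.gcd_eq_natAbs_gcd_natAbs, Int.natAbs_natCast]

/-- **Prop. 4.6 (iv), last sentence: "The greatest common divisor of the elements of `B` is equal to `g₁(2b/g₁, w)`"** for
`B = (−2b, c·2t/f; c·2t/f, −2t)`, i.e. `gcd(2b, a, 2t) = g₁ · (2b/g₁, w)` where `fa = 2tc`, `f²b = d + tc²`, `(c, f) = 1`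
("`c` a suitable integer […] satisfying `(c, f) = 1`, and `b = (d + c²t)/f²`"), `2t = fm`, `2d = fe`, `g = (m, e) = (2t/f, 2d/f)`,
`w = (g, f)`, `g = wg₁` (printed proof: "`B = g₁ (−2b/g₁, cwt₁; cwt₁, −w²f₁t₁)` […] `(cwt₁, w²f₁t₁) = wt₁(c, wf₁) = wt₁`. The
greatest common divisor of the elements of `B` is equal to `g₁(2b/g₁, w)` because `2b/g₁` and `t₁` are coprime").
[cite: GritsenkoHulekSankaran2010Symplectic, §4 Prop. 4.6 (iv) and its proof (last paragraph)] -/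
theorem gcd_entries_generalDivisorGram {t : ℕ} (ht : 0 < t) {f b c a d m e : ℤ} (hf0 : 0 < f) (hm : 2 * t = f * m)
    (he : 2 * d = f * e) (hb : f ^ 2 * b = d + t * c ^ 2) (ha : f * a = 2 * t * c) (hc : Int.gcd f c = 1) :
    Int.gcd (Int.gcd (2 * b) a) (2 * t) =
      (Int.gcd m e / Int.gcd (Int.gcd m e) f) *
        Int.gcd (2 * b / (Int.gcd m e / Int.gcd (Int.gcd m e) f : ℕ)) (Int.gcd (Int.gcd m e) f) := by
  -- `g = (m, e)`, `w = (g, f)`, `g = w n₁` (`n₁ = g₁`), `f = w f₁`, `m = g t₁`, `e = g d₁`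
  set g : ℕ := Int.gcd m e with hg
  set w : ℕ := Int.gcd (g : ℤ) f with hw
  have hm0 : 0 < m := pos_of_mul_pos_right (by rw [← hm]; positivity) hf0.le
  have hg0 : 0 < g := Int.gcd_pos_of_ne_zero_left e hm0.ne'
  have hw0 : 0 < w := Int.gcd_pos_of_ne_zero_right (g : ℤ) hf0.ne'
  have hg0' : (g : ℤ) ≠ 0 := by exact_mod_cast hg0.ne'
  have hw0' : (w : ℤ) ≠ 0 := by exact_mod_cast hw0.ne'
  have hwg : w ∣ g := Int.natCast_dvd_natCast.1 (Int.gcd_dvd_left (g : ℤ) f)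
  set n₁ : ℕ := g / w with hn₁
  have hgn : (g : ℤ) = w * n₁ := by rw [← Nat.cast_mul, Nat.mul_div_cancel' hwg]
  have hn₁0 : (n₁ : ℤ) ≠ 0 := by
    intro h0
    rw [h0, mul_zero] at hgn
    exact hg0' hgn
  obtain ⟨f₁, hf₁⟩ : (w : ℤ) ∣ f := Int.gcd_dvd_right _ _
  obtain ⟨t₁, ht₁⟩ : (g : ℤ) ∣ m := Int.gcd_dvd_left _ _
  obtain ⟨d₁, hd₁⟩ : (g : ℤ) ∣ e := Int.gcd_dvd_right _ _
  -- `(t₁, d₁) = 1`, `(n₁, f₁) = 1`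
  have hcop_td : Int.gcd t₁ d₁ = 1 := by
    have h1 : Int.gcd (m / g) (e / g) = 1 := Int.gcd_div_gcd_div_gcd hg0
    rwa [ht₁, hd₁, Int.mul_ediv_cancel_left _ hg0', Int.mul_ediv_cancel_left _ hg0'] at h1
  have hcop_nf : Int.gcd (n₁ : ℤ) f₁ = 1 := by
    have h1 : Int.gcd ((g : ℤ) / w) (f / w) = 1 := Int.gcd_div_gcd_div_gcd hw0
    rwa [hgn, hf₁, Int.mul_ediv_cancel_left _ hw0', Int.mul_ediv_cancel_left _ hw0'] at h1
  -- `2fb = e + mc²` (display (c-eq)), `a = mc`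
  have R1 : 2 * f * b = e + m * c ^ 2 :=
    mul_left_cancel₀ hf0.ne' (by linear_combination 2 * hb + he + c ^ 2 * hm)
  have R2 : a = m * c := mul_left_cancel₀ hf0.ne' (by linear_combination ha + c * hm)
  -- `2f₁b = g₁(d₁ + t₁c²)`, so `g₁ ∣ 2b`: `2b = g₁β` with `f₁β = d₁ + t₁c²`
  have R3 : 2 * b * f₁ = n₁ * (d₁ + t₁ * c ^ 2) :=
    mul_left_cancel₀ hw0' (by rw [hf₁, ht₁, hd₁, hgn] at R1; linear_combination R1)
  obtain ⟨β, hβ⟩ : (n₁ : ℤ) ∣ 2 * b :=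
    (Int.isCoprime_iff_gcd_eq_one.2 hcop_nf).dvd_of_dvd_mul_right ⟨_, R3⟩
  have R5 : f₁ * β = d₁ + t₁ * c ^ 2 := mul_left_cancel₀ hn₁0 (by rw [hβ] at R3; linear_combination R3)
  -- "`2b/g₁` and `t₁` are coprime"
  have R6 : Int.gcd β t₁ = 1 := by
    rw [Int.gcd_eq_one_iff]
    intro q hqβ hqt
    have hqd : q ∣ d₁ := by
      rw [show d₁ = f₁ * β - t₁ * c ^ 2 by rw [R5]; ring]
      exact dvd_sub (hqβ.mul_left _) (hqt.mul_right _)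
    have h1 : q ∣ (Int.gcd t₁ d₁ : ℤ) := Int.dvd_coe_gcd hqt hqd
    rwa [hcop_td, Nat.cast_one] at h1
  -- `(cwt₁, w·wf₁t₁) = wt₁ (c, f) = wt₁`
  have R7 : Int.gcd (w * t₁ * c) (w * t₁ * (w * f₁)) = (w * t₁ : ℤ).natAbs := by
    rw [Int.gcd_mul_left, ← hf₁, Int.gcd_comm, hc, mul_one]
  -- the entries: `2b = g₁β`, `a = g₁(wt₁c)`, `2t = g₁(wt₁ · wf₁)`
  have E1 : (2 * b : ℤ) = n₁ * β := hβ
  have E2 : a = n₁ * (w * t₁ * c) := by rw [R2, ht₁, hgn]; ring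
  have E3 : (2 * t : ℤ) = n₁ * (w * t₁ * (w * f₁)) := by rw [hm, hf₁, ht₁, hgn]; ring
  have E4 : 2 * b / (n₁ : ℤ) = β := by rw [E1, Int.mul_ediv_cancel_left _ hn₁0]
  rw [E4, E1, E2, E3, Int.gcd_mul_left, Int.natAbs_natCast, Nat.cast_mul, Int.gcd_mul_left, Int.natAbs_natCast,
    Int.gcd_assoc, R7, int_gcd_natAbs_right, Int.gcd_mul_left_right_of_gcd_eq_one R6]

/-- **Prop. 4.6 (iv), last sentence, for a polarisation vector of `L = B₀ ⊕ ⟨−2t⟩`**: for a primitive `h` with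
`h² = 2d`, `(h, L) = fℤ` (`f > 0`), `l_t`-coordinate `c = h.2`, and `b`, `a` with `f²b = d + c²t`, `fa = 2tc` (so that
`h^⊥ ≅ … ⊕ B`, `B = (−2b, a; a, −2t)`, row g43-#2 `restrict_orthogonal_model_equivalent_of_divisor`): the greatest common divisor
of the entries of `B` is `g₁ · (2b/g₁, w)`, `g = (2t/f, 2d/f) = wg₁`, `w = (g, f)`. `B₀` even unimodular, `t ≥ 1`.
[cite: GritsenkoHulekSankaran2010Symplectic, §4 Prop. 4.6 (iv)] -/
theorem gcd_entries_of_divisor {M : Type u} [AddCommGroup M] [Module.Finite ℤ M] [Module.Free ℤ M] {B₀ : BilinForm ℤ M}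
    (t : ℕ) (hu : B₀.IsUnimodular) (he : B₀.IsEven) (ht : 0 < t) {r r' : M × ℤ} {f d b a : ℤ} (hf : 0 < f)
    (hr : B₀.prod ((-(2 * t : ℤ)) • LinearMap.mul ℤ ℤ) r r = 2 * d) (hr0 : r ≠ 0)
    (hrsat : ∀ (k : ℤ) (w : M × ℤ), k ≠ 0 → k • w ∈ ℤ ∙ r → w ∈ ℤ ∙ r)
    (hfr : ∀ z, f ∣ B₀.prod ((-(2 * t : ℤ)) • LinearMap.mul ℤ ℤ) r z)
    (hr' : B₀.prod ((-(2 * t : ℤ)) • LinearMap.mul ℤ ℤ) r r' = f)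
    (hb : f ^ 2 * b = d + t * r.2 ^ 2) (ha : f * a = 2 * t * r.2) :
    Int.gcd (Int.gcd (2 * b) a) (2 * t) =
      (Int.gcd (2 * t / f) (2 * d / f) / Int.gcd (Int.gcd (2 * t / f) (2 * d / f)) f) *
        Int.gcd (2 * b / (Int.gcd (2 * t / f) (2 * d / f) / Int.gcd (Int.gcd (2 * t / f) (2 * d / f)) f : ℕ))
          (Int.gcd (Int.gcd (2 * t / f) (2 * d / f)) f) := by
  obtain ⟨-, hft, hc, -⟩ := divisor_data t hu he ht hr hr0 hrsat hfr hr'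
  have hfd : f ∣ 2 * d := by rw [← hr]; exact hfr r
  exact gcd_entries_generalDivisorGram ht hf (Int.mul_ediv_cancel' hft).symm (Int.mul_ediv_cancel' hfd).symm hb ha hc

end Entries

/-! ### §7 Reading note: case (iii) of Prop. 4.6 does not occur -/

section CaseThree

/-- **Case (iii) of Prop. 4.6 is vacuous for `L_{2t}`**: with `2t = fm`, `2d = fe`, `g = (m, e) = wg₁`, `f = wf₁`, `m = gt₁`,
`e = gd₁` and one admissible `c` (`(c, f) = 1`, `f² ∣ d + c²t`), if `g₁` and `f₁` are odd then `d₁` is odd — so the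
hypothesis "`g₁` and `f₁` are both odd and `d₁` is even" of (iii) is never met by a polarisation type (`2t = w²f₁g₁t₁` forces
`w` even, whereas (iii) itself requires "`w` is odd"; the printed biconditional of (iii) thus holds with both sides false).
[cite: GritsenkoHulekSankaran2010Symplectic, §4 Prop. 4.6 (iii) and proof of (ii), (iii)] -/
theorem odd_of_admissible_of_odd_of_odd {t : ℕ} (ht : 0 < t) {f m e d c : ℤ} (hf0 : 0 < f) (hm : 2 * t = f * m)
    (he : 2 * d = f * e) (h : f ^ 2 ∣ d + t * c ^ 2) (hc : Int.gcd f c = 1)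
    (hg₁ : Odd ((Int.gcd m e : ℤ) / Int.gcd (Int.gcd m e) f))
    (hf₁ : Odd (f / Int.gcd (Int.gcd m e) f)) :
    Odd (e / Int.gcd m e) := by
  set g : ℕ := Int.gcd m e with hg
  set w : ℕ := Int.gcd (g : ℤ) f with hw
  have hm0 : 0 < m := pos_of_mul_pos_right (by rw [← hm]; positivity) hf0.le
  have hg0 : 0 < g := Int.gcd_pos_of_ne_zero_left e hm0.ne'
  have hg0' : (g : ℤ) ≠ 0 := by exact_mod_cast hg0.ne'
  have hw0' : (w : ℤ) ≠ 0 := by exact_mod_cast (Int.gcd_pos_of_ne_zero_right (g : ℤ) hf0.ne').ne'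
  obtain ⟨n₁, hgn⟩ : (w : ℤ) ∣ g := Int.gcd_dvd_left _ _
  obtain ⟨f₁, hf₁'⟩ : (w : ℤ) ∣ f := Int.gcd_dvd_right _ _
  obtain ⟨t₁, ht₁⟩ : (g : ℤ) ∣ m := Int.gcd_dvd_left _ _
  obtain ⟨d₁, hd₁⟩ : (g : ℤ) ∣ e := Int.gcd_dvd_right _ _
  rw [hgn, Int.mul_ediv_cancel_left _ hw0'] at hg₁
  rw [hf₁', Int.mul_ediv_cancel_left _ hw0'] at hf₁
  rw [hd₁, Int.mul_ediv_cancel_left _ hg0']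
  have hcop_td : Int.gcd t₁ d₁ = 1 := by
    have h1 : Int.gcd (m / g) (e / g) = 1 := Int.gcd_div_gcd_div_gcd hg0
    rwa [ht₁, hd₁, Int.mul_ediv_cancel_left _ hg0', Int.mul_ediv_cancel_left _ hg0'] at h1
  -- `g₁(d₁ + t₁c²) = 2f₁q`
  obtain ⟨q, hq⟩ := h
  have k1 : e + m * c ^ 2 = 2 * f * q := mul_left_cancel₀ hf0.ne' (by linear_combination -he - c ^ 2 * hm + 2 * hq)
  have k2 : (g : ℤ) * (d₁ + t₁ * c ^ 2) = 2 * f * q := by rw [← k1, ht₁, hd₁]; ring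
  have R1 : n₁ * (d₁ + t₁ * c ^ 2) = 2 * f₁ * q := by
    rw [hgn, hf₁'] at k2
    exact mul_left_cancel₀ hw0' (by linear_combination k2)
  -- `d₁ + t₁c²` is even
  have hev : Even (d₁ + t₁ * c ^ 2) := by
    have h2 : Even (n₁ * (d₁ + t₁ * c ^ 2)) := ⟨f₁ * q, by rw [R1]; ring⟩
    exact (Int.even_mul.1 h2).resolve_left (Int.not_even_iff_odd.2 hg₁)
  by_contra hd
  rw [Int.not_odd_iff_even] at hd
  have htc : Even (t₁ * c ^ 2) := by simpa [Int.even_add, hd] using hev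
  rcases Int.even_mul.1 htc with ht₁e | hce
  · -- `t₁`, `d₁` both even: contradicts `(t₁, d₁) = 1`
    have h2 : (2 : ℤ) ∣ (Int.gcd t₁ d₁ : ℤ) := Int.dvd_coe_gcd (even_iff_two_dvd.1 ht₁e) (even_iff_two_dvd.1 hd)
    rw [hcop_td] at h2
    norm_num at h2
  · -- `c` even; `t₁` odd, so `2t = w²f₁g₁t₁` forces `w` even, `f` even: contradicts `(f, c) = 1`
    have hce' : Even c := by
      rcases Int.even_or_odd c with h | h
      · exact h
      · exact absurd hce (Int.not_even_iff_odd.2 (h.pow))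
    have ht₁o : Odd t₁ := by
      rcases Int.even_or_odd t₁ with h | h
      · exfalso
        have h2 : (2 : ℤ) ∣ (Int.gcd t₁ d₁ : ℤ) := Int.dvd_coe_gcd (even_iff_two_dvd.1 h) (even_iff_two_dvd.1 hd)
        rw [hcop_td] at h2
        norm_num at h2
      · exact h
    have hwe : Even (w : ℤ) := by
      have h2 : Even ((w : ℤ) * w * (f₁ * n₁ * t₁)) := ⟨t, by
        have e1 : (2 * t : ℤ) = w * f₁ * (w * n₁ * t₁) := by rw [hm, hf₁', ht₁, hgn]
        linear_combination -e1⟩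
      rcases Int.even_mul.1 h2 with h | h
      · rcases Int.even_mul.1 h with h | h <;> exact h
      · exact absurd h (Int.not_even_iff_odd.2 ((hf₁.mul hg₁).mul ht₁o))
    have hfe : (2 : ℤ) ∣ f := by rw [hf₁']; exact (even_iff_two_dvd.1 hwe).mul_right _
    have h2 : (2 : ℤ) ∣ (Int.gcd f c : ℤ) := Int.dvd_coe_gcd hfe (even_iff_two_dvd.1 hce')
    rw [hc] at h2
    norm_num at h2

end CaseThree


end Literature.Topology.FourManifolds
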